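import Mathlib.Analysis.InnerProductSpace.Calculus
import Mathlib.Analysis.InnerProductSpace.Dual
import Mathlib.Analysis.Calculus.Gradient.Basic
import Mathlib.Analysis.Calculus.Deriv.Mul
import Mathlib.Analysis.Calculus.Deriv.Comp
import Mathlib.Analysis.Calculus.Deriv.Inv
import Mathlib.Analysis.SpecialFunctions.Pow.Deriv
import Literature.Analysis.FluidPDE.CompressibleEulerImplosion
import HarnessLib

/-!
# The exact self-similar implosion of the monatomic gas on `ℝ³` (theorems only)

Topic `Literature/Analysis/FluidPDE`; namespace `Literature.Analysis.FluidPDE`. Companion of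
`CompressibleEulerImplosion.lean` (named facts `BuckmasterCaolaboraGomezserrano2025_thm11_monatomic`,
the `γ = 5/3` self-similar PROFILE of Buckmaster–Cao-Labora–Gómez-Serrano, arXiv:2208.09445 = Forum
Math. Pi 13 (2025), Thm 1.1, and `CaolaboraEtAl2025_thm12_euler`) and of
`CompressibleEulerImplosionRates.lean` (named fact `CaolaboraEtAl2025_thm12_rates`, the
Cao-Labora–Gómez-Serrano–Shi–Staffilani implosion on `𝕋³` with its rates, arXiv:2310.05325 = Camb.
J. Math. 13 (2025), Thm 1.2). THEOREMS ONLY, no new facts (D-0026).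

Both implosion theorems are built on ONE exact object: the self-similar solution of the isentropic
compressible Euler equations generated by a smooth radial profile `(Ū, S̄)` (CGSS, §1.3, p. 5 of
the held text `paper-arxiv-2310.05325`: "there exist radially symmetric profiles `(Ū, S̄)` that
solve [the self-similar equations] for `ν = 0` … That is [the PROFILE EQUATIONS, last display of
p. 5; (1.9) in the arXiv numbering] `(r−1)Ū + (y + Ū)·∇Ū + αS̄∇S̄ = 0`,
`(r−1)S̄ + (y + Ū)·∇S̄ + αS̄ div Ū = 0`"; BCG, Thm 1.1, p. 4 of `paper-arxiv-2208.09445`: "This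
gives a smooth and radially symmetric self-similar solution to [the radial isentropic Euler
equations] of the form [of the self-similar ansatz]"). Equation numbers of §1.3 of CGSS are quoted
below by their role on p. 5 (the held text carries LaTeX labels, not numbers). For `γ = 5/3`
(`α = (γ−1)/2 = 1/3`, rescaled sound speed `σ = α⁻¹ρ^α = 3ρ^{1/3}`, so `ρ = (σ/3)³`) the
SELF-SIMILAR CHANGE OF VARIABLES of §1.3 (third and fourth displays of p. 5) is

  `u(x,t) = r⁻¹(T−t)^{1/r−1} Ū(y)`, `σ(x,t) = r⁻¹(T−t)^{1/r−1} S̄(y)`, `y = x/(T−t)^{1/r}`,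

and the `(u, σ)` FORM of (1.1) with `ν = 0` is (second display of p. 5, "the equations for `u, σ`
read") `∂ₜu = −u∇u − ασ∇σ`, `∂ₜσ = −ασ div u − ∇σ·u`. (The held arXiv text prints `+ασ∇σ` in
that one display — a sign misprint: the derivation displayed just before it ends with
`ρ∂ₜu + ρu∇u = −αρσ∇σ + νΔu`, and the self-similar system that follows has `−αS∇S`; the sign
used here is the consistent one, and it is CHECKED below by deriving (1.1) back from it,
`euler_of_uσ`.) This file proves, in Mathlib's calculus on
`EuclideanSpace ℝ (Fin 3)` (`fderiv`, `gradient`, `deriv`):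

* `profileEq_velocity`, `profileEq_soundSpeed`: the RADIAL profile equations of the vendored fact
  `BuckmasterCaolaboraGomezserrano2025_thm11_monatomic` (`(r−1)U + (ζ+U)U′ + ⅓SS′ = 0`,
  `(r−1)S + (ζ+U)S′ + ⅓S(U′ + 2U/ζ) = 0` for `ζ > 0`, smooth radial fields on `ℝ³`) give the
  VECTOR profile equations at every `y ∈ ℝ³` (at `y = 0` by continuity of the residual);
* `uσ_system_of_ansatz`: for any `C¹` stationary solution `(Ū, S̄)` of the profile equations the
  ansatz solves the
  `(u, σ)`-system on `(−∞, T) × ℝ³` (the powers of `T − t`: `hasDerivAt_ssAmplitude`,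
  `hasDerivAt_ssScale`, and the identities `a e′ = κ e`, `a²e = κ`, `a e = (r(T−t))⁻¹`);
* `euler_of_uσ`: the `(u, σ)`-system with `σ > 0`, `ρ = (σ/3)³`, is the isentropic Euler system
  `∂ₜρ + ∑ᵢ∂ᵢ(ρuᵢ) = 0`, `ρ∂ₜu + ρ∑ᵢuᵢ∂ᵢu + ∇(ρ^{5/3}/(5/3)) = 0` (pointwise);
* `exactSolution_of_profile`: hence a profile as in the vendored fact yields, for every `T`, a
  jointly `C^∞` solution `(ρ, u)` on `(−∞, T) × ℝ³` with `ρ > 0`, central density EXACTLY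
  `ρ(t,0) = (S(0)/(3r))³ (T−t)^{−3(1−1/r)}` (the core-growth law of `CaolaboraEtAl2025_thm12_rates`)
  and the Type-I identities `∇u = (r(T−t))⁻¹∇Ū(y)`, `∇ρ^{1/3} = ⅓(r(T−t))⁻¹∇S̄(y)`;
* `exact_selfSimilar_implosion_of_thm11_monatomic`: the existential corollary from the vendored fact;
* `tendsto_deriv_profile_atTop`, `exists_bound_fderiv_profile`: the end point `P_∞ = (0,0)` of the
  profile (`U/ζ, S/ζ → 0`) and the profile equations force `U′, S′ → 0`, so `∇Ū`, `∇S̄` are bounded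
  on `ℝ³`; hence `typeI_of_profile`: `‖∂ᵢu(t,·)‖_∞ + ‖∂ᵢρ^{1/3}(t,·)‖_∞ ≤ C/(T−t)` (Type I), and the
  corollary `exact_selfSimilar_implosion_typeI_of_thm11_monatomic`;
* `profile_energy_deriv_le`, `profile_sq_le_rpow`, `exists_bound_profile`: for `r > 1` the profile
  energy `U² + S²` obeys `(U²+S²)′ ≤ −(2(r−1)/3)(U²+S²)/ζ` at infinity, hence decays at least like
  `ζ^{−2(r−1)/3}` and the profile fields `Ū`, `S̄` are bounded on `ℝ³`; hence
  `speed_bound_of_profile`: the characteristic speed of the exact solution is bounded, uniformly in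
  `x`, by the INTEGRABLE function `C r⁻¹ (T−t)^{1/r−1}` of time — the input of the
  domain-of-dependence argument near the implosion
  (`IsentropicEulerFiniteSpeedOfPropagation.lean`, variable-speed form).

What is NOT here: periodicity (`𝕋³`), which is the whole difficulty of Thm 1.2 of CGSS (truncation,
linear stability Prop. 1.8, bootstrap Prop. 3.3) — see `CompressibleEulerImplosionRates.lean`.
-/

noncomputable section

open Set Filter Topology InnerProductSpace
open scoped ContDiff RealInnerProductSpace

namespace Literature.Analysis.FluidPDE

open Literature.MathematicalPhysics.KineticTheory (V3)

namespace CaolaboraEtAl2025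

/-! ### The powers of `T − t` in the self-similar change of variables (`α = 1/3`) -/

section Scalars

/-- The amplitude `τ ↦ r⁻¹ (T−τ)^{1/r−1}` of the self-similar change of variables has derivative
`(r−1) · r⁻² (T−t)^{1/r−2}` at `t < T`.
[cite: CaolaboraEtAl2025, §1.3 p. 5, self-similar change of variables] -/
theorem hasDerivAt_ssAmplitude {T r t : ℝ} (hr : r ≠ 0) (ht : t < T) :
    HasDerivAt (fun τ => r⁻¹ * (T - τ) ^ (1 / r - 1))
      ((r - 1) * (r⁻¹ ^ 2 * (T - t) ^ (1 / r - 2))) t := by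
  have hl : T - t ≠ 0 := (sub_pos.mpr ht).ne'
  have h1 : HasDerivAt (fun τ => T - τ) (-1) t := by
    simpa using (hasDerivAt_id t).const_sub T
  have h2 := (h1.rpow_const (p := 1 / r - 1) (Or.inl hl)).const_mul r⁻¹
  refine h2.congr_deriv ?_
  rw [show (1 / r - 1 - 1 : ℝ) = 1 / r - 2 by ring]
  field_simp
  ring

/-- The scale `τ ↦ (T−τ)^{−1/r}` of the self-similar variable `y = x/(T−t)^{1/r}` has derivative
`r⁻¹ (T−t)^{−1/r−1}` at `t < T`. [cite: CaolaboraEtAl2025, §1.3 p. 5, `y = x/(T−t)^{1/r}`] -/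
theorem hasDerivAt_ssScale {T r t : ℝ} (ht : t < T) :
    HasDerivAt (fun τ => (T - τ) ^ (-1 / r)) (r⁻¹ * (T - t) ^ (-1 / r - 1)) t := by
  have hl : T - t ≠ 0 := (sub_pos.mpr ht).ne'
  have h1 : HasDerivAt (fun τ => T - τ) (-1) t := by
    simpa using (hasDerivAt_id t).const_sub T
  refine (h1.rpow_const (p := -1 / r) (Or.inl hl)).congr_deriv ?_
  ring

/-- `a · e′ = κ · e` with `a = r⁻¹λ^{1/r−1}`, `e = λ^{−1/r}`, `e′ = r⁻¹λ^{−1/r−1}`,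
`κ = r⁻²λ^{1/r−2}` (`λ = T − t > 0`). [folklore] -/
theorem ssAmplitude_mul_dScale {l r : ℝ} (hl : 0 < l) :
    r⁻¹ * l ^ (1 / r - 1) * (r⁻¹ * l ^ (-1 / r - 1)) =
      r⁻¹ ^ 2 * l ^ (1 / r - 2) * l ^ (-1 / r) := by
  have h1 : l ^ (1 / r - 1) * l ^ (-1 / r - 1) = l ^ (-2 : ℝ) := by
    rw [← Real.rpow_add hl]; congr 1; ring
  have h2 : l ^ (1 / r - 2) * l ^ (-1 / r) = l ^ (-2 : ℝ) := by
    rw [← Real.rpow_add hl]; congr 1; ring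
  calc r⁻¹ * l ^ (1 / r - 1) * (r⁻¹ * l ^ (-1 / r - 1))
        = r⁻¹ ^ 2 * (l ^ (1 / r - 1) * l ^ (-1 / r - 1)) := by ring
    _ = r⁻¹ ^ 2 * (l ^ (1 / r - 2) * l ^ (-1 / r)) := by rw [h1, h2]
    _ = _ := by ring

/-- `a² · e = κ`. [folklore] -/
theorem ssAmplitude_sq_mul_scale {l r : ℝ} (hl : 0 < l) :
    (r⁻¹ * l ^ (1 / r - 1)) ^ 2 * l ^ (-1 / r) = r⁻¹ ^ 2 * l ^ (1 / r - 2) := by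
  have h1 : (l ^ (1 / r - 1)) ^ 2 * l ^ (-1 / r) = l ^ (1 / r - 2) := by
    rw [sq, ← Real.rpow_add hl, ← Real.rpow_add hl]; congr 1; ring
  rw [mul_pow, mul_assoc, h1]

/-- `a · e = r⁻¹ λ⁻¹`. [folklore] -/
theorem ssAmplitude_mul_scale {l r : ℝ} (hl : 0 < l) :
    r⁻¹ * l ^ (1 / r - 1) * l ^ (-1 / r) = r⁻¹ * l⁻¹ := by
  have h1 : l ^ (1 / r - 1) * l ^ (-1 / r) = l⁻¹ := by
    rw [← Real.rpow_add hl, ← Real.rpow_neg_one]; congr 1; ring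
  rw [mul_assoc, h1]

end Scalars

/-! ### Radial fields on an inner-product space: derivatives away from the origin -/

section Radial

variable {F : Type*} [NormedAddCommGroup F] [InnerProductSpace ℝ F]

/-- The norm is differentiable away from the origin with derivative `v ↦ ⟪ξ/|ξ|, v⟫`. [folklore] -/
theorem hasFDerivAt_norm_of_ne {ξ : F} (hξ : ξ ≠ 0) :
    HasFDerivAt (fun x : F => ‖x‖) (‖ξ‖⁻¹ • innerSL ℝ ξ) ξ := by
  have h1 : HasFDerivAt (fun x : F => ‖x‖ ^ 2) (2 • innerSL ℝ ξ) ξ :=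
    (hasStrictFDerivAt_norm_sq ξ).hasFDerivAt
  have h2 : HasDerivAt (fun y : ℝ => Real.sqrt y) (1 / (2 * Real.sqrt (‖ξ‖ ^ 2))) (‖ξ‖ ^ 2) :=
    Real.hasDerivAt_sqrt (pow_ne_zero 2 (norm_ne_zero_iff.2 hξ))
  have h3 := h2.comp_hasFDerivAt ξ h1
  have heq : ((fun y : ℝ => Real.sqrt y) ∘ fun x : F => ‖x‖ ^ 2) = fun x => ‖x‖ := by
    funext x; exact Real.sqrt_sq (norm_nonneg x)
  have hn : ‖ξ‖ ≠ 0 := norm_ne_zero_iff.2 hξ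
  have hderiv : (1 / (2 * Real.sqrt (‖ξ‖ ^ 2))) • (2 • innerSL ℝ ξ) = ‖ξ‖⁻¹ • innerSL ℝ ξ := by
    ext v
    rw [Real.sqrt_sq (norm_nonneg ξ)]
    simp only [two_smul, FunLike.coe_smul, Pi.smul_apply, add_apply,
      smul_eq_mul]
    field_simp
    ring
  rw [heq, hderiv] at h3
  exact h3

/-- Derivative of a radial scalar field `z ↦ S ‖z‖` away from the origin. [folklore] -/
theorem hasFDerivAt_radialScalar {S : ℝ → ℝ} {S' : ℝ} {y : F} (hy : y ≠ 0)
    (hS : HasDerivAt S S' ‖y‖) :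
    HasFDerivAt (fun z : F => S ‖z‖) (S' • (‖y‖⁻¹ • innerSL ℝ y)) y :=
  hS.comp_hasFDerivAt y (hasFDerivAt_norm_of_ne hy)

/-- Gradient of a radial scalar field `z ↦ S ‖z‖` away from the origin: `S′(|y|) y/|y|`. [folklore] -/
theorem hasGradientAt_radialScalar [CompleteSpace F] {S : ℝ → ℝ} {S' : ℝ} {y : F} (hy : y ≠ 0)
    (hS : HasDerivAt S S' ‖y‖) :
    HasGradientAt (fun z : F => S ‖z‖) ((S' * ‖y‖⁻¹) • y) y := by
  have heq : toDual ℝ F ((S' * ‖y‖⁻¹) • y) = S' • (‖y‖⁻¹ • innerSL ℝ y) := by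
    ext v
    rw [InnerProductSpace.toDual_apply_apply, real_inner_smul_left, smul_smul]
    rfl
  rw [hasGradientAt_iff_hasFDerivAt, heq]
  exact hasFDerivAt_radialScalar hy hS

/-- Derivative of a radial vector field `z ↦ (U ‖z‖ / ‖z‖) • z` away from the origin. [folklore] -/
theorem hasFDerivAt_radialField {U : ℝ → ℝ} {U' : ℝ} {y : F} (hy : y ≠ 0)
    (hU : HasDerivAt U U' ‖y‖) :
    HasFDerivAt (fun z : F => (U ‖z‖ / ‖z‖) • z)
      ((U ‖y‖ / ‖y‖) • ContinuousLinearMap.id ℝ F +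
        (((U' * ‖y‖ - U ‖y‖ * 1) / ‖y‖ ^ 2) • (‖y‖⁻¹ • innerSL ℝ y)).smulRight y) y := by
  have hn : ‖y‖ ≠ 0 := norm_ne_zero_iff.2 hy
  have hφ : HasDerivAt (fun s => U s / s) ((U' * ‖y‖ - U ‖y‖ * 1) / ‖y‖ ^ 2) ‖y‖ :=
    hU.div (hasDerivAt_id ‖y‖) hn
  have hc : HasFDerivAt (fun z : F => U ‖z‖ / ‖z‖)
      (((U' * ‖y‖ - U ‖y‖ * 1) / ‖y‖ ^ 2) • (‖y‖⁻¹ • innerSL ℝ y)) y :=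
    hφ.comp_hasFDerivAt y (hasFDerivAt_norm_of_ne hy)
  exact hc.smul (hasFDerivAt_id y)

end Radial

/-! ### The radial profile solves the profile equations in vector form on `ℝ³` -/

section Profile

/-- `|s e₀| = s` for `s > 0`, `e₀ = (1, 0, 0)`. [folklore] -/
theorem norm_smul_e0 {s : ℝ} (hs : 0 < s) : ‖s • (EuclideanSpace.single 0 1 : V3)‖ = s := by
  rw [norm_smul, PiLp.norm_single, norm_one, mul_one, Real.norm_eq_abs, abs_of_pos hs]

/-- Along the ray through `e₀ = (1, 0, 0)` the radial field IS the profile: `Ū(s e₀) = U(s) e₀`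
for `s > 0`. [folklore] -/
theorem radialField_ray (U : ℝ → ℝ) {s : ℝ} (hs : 0 < s) :
    (U ‖s • (EuclideanSpace.single 0 1 : V3)‖ / ‖s • (EuclideanSpace.single 0 1 : V3)‖) •
        (s • (EuclideanSpace.single 0 1 : V3)) = U s • (EuclideanSpace.single 0 1 : V3) := by
  rw [norm_smul_e0 hs, smul_smul, div_mul_cancel₀ _ hs.ne']

/-- Smoothness of the radial velocity field `y ↦ U(|y|) y/|y|` on `ℝ³` (as recorded in the vendored
profile fact) makes the profile `U` smooth on `(0, ∞)`. [folklore] -/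
theorem contDiffAt_profile_of_radialField {U : ℝ → ℝ}
    (hU : ContDiff ℝ ∞ fun y : V3 => (U ‖y‖ / ‖y‖) • y) {ζ : ℝ} (hζ : 0 < ζ) :
    ContDiffAt ℝ ∞ U ζ := by
  have h1 : ContDiffAt ℝ ∞ (fun s : ℝ =>
      ⟪(U ‖s • (EuclideanSpace.single 0 1 : V3)‖ / ‖s • (EuclideanSpace.single 0 1 : V3)‖) •
          (s • (EuclideanSpace.single 0 1 : V3)), (EuclideanSpace.single 0 1 : V3)⟫) ζ :=
    ((hU.comp (contDiff_id.smul contDiff_const)).contDiffAt).inner ℝ contDiffAt_const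
  refine h1.congr_of_eventuallyEq ?_
  filter_upwards [Ioi_mem_nhds hζ] with s hs
  rw [radialField_ray U hs, real_inner_smul_left, real_inner_self_eq_norm_sq, PiLp.norm_single,
    norm_one, one_pow, mul_one]

/-- Smoothness of the radial scalar field `y ↦ S(|y|)` on `ℝ³` makes `S` smooth on `(0, ∞)`.
[folklore] -/
theorem contDiffAt_profile_of_radialScalar {S : ℝ → ℝ} (hS : ContDiff ℝ ∞ fun y : V3 => S ‖y‖)
    {ζ : ℝ} (hζ : 0 < ζ) : ContDiffAt ℝ ∞ S ζ := by
  have h1 : ContDiffAt ℝ ∞ (fun s : ℝ => S ‖s • (EuclideanSpace.single 0 1 : V3)‖) ζ :=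
    (hS.comp (contDiff_id.smul contDiff_const)).contDiffAt
  refine h1.congr_of_eventuallyEq ?_
  filter_upwards [Ioi_mem_nhds hζ] with s hs
  rw [norm_smul_e0 hs]

/-- The coordinate trace (divergence) of the derivative of a radial field at `y ≠ 0`:
`div (φ(|y|) y) = 3 φ + |y| φ′`. [folklore] -/
theorem trace_fderiv_radialField (φ φ' : ℝ) (y : V3) :
    ∑ i, ((φ • ContinuousLinearMap.id ℝ V3 +
        (φ' • (‖y‖⁻¹ • innerSL ℝ y)).smulRight y) (EuclideanSpace.single i 1)) i =
      3 * φ + φ' * (‖y‖⁻¹ * ‖y‖ ^ 2) := by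
  have hsum : ∑ i : Fin 3, y i * y i = ‖y‖ ^ 2 := by
    rw [EuclideanSpace.real_norm_sq_eq]
    exact Finset.sum_congr rfl fun i _ => (sq (y i)).symm
  have hterm : ∀ i : Fin 3, ((φ • ContinuousLinearMap.id ℝ V3 +
      (φ' • (‖y‖⁻¹ • innerSL ℝ y)).smulRight y) (EuclideanSpace.single i 1)) i =
      φ + φ' * ‖y‖⁻¹ * (y i * y i) := by
    intro i
    simp only [add_apply, FunLike.coe_smul, Pi.smul_apply,
      ContinuousLinearMap.id_apply, ContinuousLinearMap.smulRight_apply, innerSL_apply_apply,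
      EuclideanSpace.inner_single_right, PiLp.add_apply, PiLp.smul_apply, PiLp.single_apply,
      smul_eq_mul, if_true, conj_trivial]
    ring
  rw [Finset.sum_congr rfl fun i _ => hterm i, Finset.sum_add_distrib, ← Finset.mul_sum, hsum]
  simp only [Finset.sum_const, Finset.card_univ, Fintype.card_fin, nsmul_eq_mul, Nat.cast_ofNat]
  ring

variable {r : ℝ} {U S : ℝ → ℝ}

/-- **First profile equation in vector form, away from the origin.** If the radial profiles
satisfy `(r−1)U + (ζ+U)U′ + ⅓ S S′ = 0` at `ζ = |y| > 0`, then the fields `Ū(y) = U(|y|) y/|y|`,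
`S̄(y) = S(|y|)` satisfy `(r−1)Ū + (y + Ū)·∇Ū + ⅓ S̄ ∇S̄ = 0` at `y` (first profile equation of the
source, `α = 1/3`). [cite: CaolaboraEtAl2025, §1.3 p. 5, profile equations (last display)] -/
theorem profileEq_velocity_of_ne_zero {y : V3} (hy : y ≠ 0) {U' S' : ℝ}
    (hUd : HasDerivAt U U' ‖y‖) (hSd : HasDerivAt S S' ‖y‖)
    (h₁ : (r - 1) * U ‖y‖ + (‖y‖ + U ‖y‖) * U' + 1 / 3 * S ‖y‖ * S' = 0) :
    (r - 1) • ((U ‖y‖ / ‖y‖) • y) +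
        fderiv ℝ (fun z : V3 => (U ‖z‖ / ‖z‖) • z) y (y + (U ‖y‖ / ‖y‖) • y) +
      (1 / 3 * S ‖y‖) • gradient (fun z : V3 => S ‖z‖) y = 0 := by
  have hn : ‖y‖ ≠ 0 := norm_ne_zero_iff.2 hy
  rw [(hasFDerivAt_radialField hy hUd).fderiv, (hasGradientAt_radialScalar hy hSd).gradient,
    show y + (U ‖y‖ / ‖y‖) • y = (1 + U ‖y‖ / ‖y‖) • y by rw [add_smul, one_smul], map_smul]
  simp only [add_apply, FunLike.coe_smul, Pi.smul_apply,
    ContinuousLinearMap.id_apply, ContinuousLinearMap.smulRight_apply, innerSL_apply_apply,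
    real_inner_self_eq_norm_sq, smul_eq_mul, smul_smul, ← add_smul]
  refine smul_eq_zero.mpr (Or.inl ?_)
  field_simp
  linear_combination 3 * ‖y‖ * h₁

/-- **Second profile equation in vector form, away from the origin.** If the radial profiles
satisfy `(r−1)S + (ζ+U)S′ + ⅓ S (U′ + 2U/ζ) = 0` at `ζ = |y| > 0`, then
`(r−1)S̄ + (y + Ū)·∇S̄ + ⅓ S̄ div Ū = 0` at `y` (second profile equation of the source).
[cite: CaolaboraEtAl2025, §1.3 p. 5, profile equations (last display)] -/
theorem profileEq_soundSpeed_of_ne_zero {y : V3} (hy : y ≠ 0) {U' S' : ℝ}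
    (hUd : HasDerivAt U U' ‖y‖) (hSd : HasDerivAt S S' ‖y‖)
    (h₂ : (r - 1) * S ‖y‖ + (‖y‖ + U ‖y‖) * S' + 1 / 3 * S ‖y‖ * (U' + 2 * U ‖y‖ / ‖y‖) = 0) :
    (r - 1) * S ‖y‖ + fderiv ℝ (fun z : V3 => S ‖z‖) y (y + (U ‖y‖ / ‖y‖) • y) +
      1 / 3 * S ‖y‖ * ∑ i, (fderiv ℝ (fun z : V3 => (U ‖z‖ / ‖z‖) • z) y
        (EuclideanSpace.single i 1)) i = 0 := by
  have hn : ‖y‖ ≠ 0 := norm_ne_zero_iff.2 hy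
  rw [(hasFDerivAt_radialField hy hUd).fderiv, (hasFDerivAt_radialScalar hy hSd).fderiv,
    trace_fderiv_radialField,
    show y + (U ‖y‖ / ‖y‖) • y = (1 + U ‖y‖ / ‖y‖) • y by rw [add_smul, one_smul], map_smul]
  simp only [FunLike.coe_smul, Pi.smul_apply, innerSL_apply_apply,
    real_inner_self_eq_norm_sq, smul_eq_mul]
  field_simp
  field_simp at h₂
  linear_combination h₂

/-- **First profile equation, in vector form, on all of `ℝ³`** — for profiles as in the
vendored fact `BuckmasterCaolaboraGomezserrano2025_thm11_monatomic` (smooth radial fields on `ℝ³`,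
radial ODEs for `ζ > 0`): `(r−1)Ū + (y + Ū)·∇Ū + ⅓ S̄∇S̄ = 0`, i.e. `(Ū, S̄)` is a stationary
solution of the self-similar system (CGSS: "there exist radially symmetric profiles `(Ū, S̄)` that
solve [the self-similar equations] for `ν = 0` … That is [the profile equations]"). At `y = 0` the
identity follows by continuity. [cite: CaolaboraEtAl2025, §1.3 p. 5, profile equations (last display)] -/
theorem profileEq_velocity (hU : ContDiff ℝ ∞ fun y : V3 => (U ‖y‖ / ‖y‖) • y)
    (hS : ContDiff ℝ ∞ fun y : V3 => S ‖y‖)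
    (hode : ∀ ζ : ℝ, 0 < ζ →
      (r - 1) * U ζ + (ζ + U ζ) * deriv U ζ + 1 / 3 * S ζ * deriv S ζ = 0 ∧
      (r - 1) * S ζ + (ζ + U ζ) * deriv S ζ + 1 / 3 * S ζ * (deriv U ζ + 2 * U ζ / ζ) = 0)
    (y : V3) :
    (r - 1) • ((U ‖y‖ / ‖y‖) • y) +
        fderiv ℝ (fun z : V3 => (U ‖z‖ / ‖z‖) • z) y (y + (U ‖y‖ / ‖y‖) • y) +
      (1 / 3 * S ‖y‖) • gradient (fun z : V3 => S ‖z‖) y = 0 := by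
  set R : V3 → V3 := fun y => (r - 1) • ((U ‖y‖ / ‖y‖) • y) +
        fderiv ℝ (fun z : V3 => (U ‖z‖ / ‖z‖) • z) y (y + (U ‖y‖ / ‖y‖) • y) +
      (1 / 3 * S ‖y‖) • gradient (fun z : V3 => S ‖z‖) y with hR
  have hcont : Continuous R := by
    have h1 : Continuous (fderiv ℝ fun z : V3 => (U ‖z‖ / ‖z‖) • z) :=
      hU.continuous_fderiv (by simp)
    have h2 : Continuous fun y => gradient (fun z : V3 => S ‖z‖) y :=
      (toDual ℝ V3).symm.continuous.comp (hS.continuous_fderiv (by simp))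
    exact (((continuous_const (y := r - 1)).smul hU.continuous).add
      (h1.clm_apply (continuous_id.add hU.continuous))).add
      ((continuous_const.mul hS.continuous).smul h2)
  have hzero : ∀ z : V3, z ≠ 0 → R z = 0 := by
    intro z hz
    have hζ : 0 < ‖z‖ := norm_pos_iff.mpr hz
    have hUd := ((contDiffAt_profile_of_radialField hU hζ).differentiableAt (by simp)).hasDerivAt
    have hSd := ((contDiffAt_profile_of_radialScalar hS hζ).differentiableAt (by simp)).hasDerivAt
    exact profileEq_velocity_of_ne_zero hz hUd hSd (hode ‖z‖ hζ).1
  have hRz : R = 0 := by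
    haveI : NeBot (𝓝[≠] (0 : V3)) := Module.punctured_nhds_neBot ℝ V3 0
    exact Continuous.ext_on (dense_compl_singleton 0) hcont continuous_const fun z hz => hzero z hz
  exact congrFun hRz y

/-- **Second profile equation on all of `ℝ³`**: `(r−1)S̄ + (y + Ū)·∇S̄ + ⅓ S̄ div Ū = 0`, the
divergence written as the coordinate trace `∑ᵢ (∂ᵢŪ)ᵢ`.
[cite: CaolaboraEtAl2025, §1.3 p. 5, profile equations (last display)] -/
theorem profileEq_soundSpeed (hU : ContDiff ℝ ∞ fun y : V3 => (U ‖y‖ / ‖y‖) • y)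
    (hS : ContDiff ℝ ∞ fun y : V3 => S ‖y‖)
    (hode : ∀ ζ : ℝ, 0 < ζ →
      (r - 1) * U ζ + (ζ + U ζ) * deriv U ζ + 1 / 3 * S ζ * deriv S ζ = 0 ∧
      (r - 1) * S ζ + (ζ + U ζ) * deriv S ζ + 1 / 3 * S ζ * (deriv U ζ + 2 * U ζ / ζ) = 0)
    (y : V3) :
    (r - 1) * S ‖y‖ + fderiv ℝ (fun z : V3 => S ‖z‖) y (y + (U ‖y‖ / ‖y‖) • y) +
      1 / 3 * S ‖y‖ * ∑ i, (fderiv ℝ (fun z : V3 => (U ‖z‖ / ‖z‖) • z) y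
        (EuclideanSpace.single i 1)) i = 0 := by
  set R : V3 → ℝ := fun y => (r - 1) * S ‖y‖ +
      fderiv ℝ (fun z : V3 => S ‖z‖) y (y + (U ‖y‖ / ‖y‖) • y) +
      1 / 3 * S ‖y‖ * ∑ i, (fderiv ℝ (fun z : V3 => (U ‖z‖ / ‖z‖) • z) y
        (EuclideanSpace.single i 1)) i with hR
  have hcont : Continuous R := by
    have h1 : Continuous (fderiv ℝ fun z : V3 => (U ‖z‖ / ‖z‖) • z) :=
      hU.continuous_fderiv (by simp)
    have h2 : Continuous (fderiv ℝ fun z : V3 => S ‖z‖) := hS.continuous_fderiv (by simp)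
    have h3 : Continuous fun y : V3 => ∑ i, (fderiv ℝ (fun z : V3 => (U ‖z‖ / ‖z‖) • z) y
        (EuclideanSpace.single i 1)) i := by
      refine continuous_finsetSum _ fun i _ => ?_
      exact (PiLp.continuous_apply 2 (fun _ : Fin 3 => ℝ) i).comp (h1.clm_apply continuous_const)
    exact ((continuous_const.mul hS.continuous).add
      (h2.clm_apply (continuous_id.add hU.continuous))).add
      ((continuous_const.mul hS.continuous).mul h3)
  have hzero : ∀ z : V3, z ≠ 0 → R z = 0 := by
    intro z hz
    have hζ : 0 < ‖z‖ := norm_pos_iff.mpr hz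
    have hUd := ((contDiffAt_profile_of_radialField hU hζ).differentiableAt (by simp)).hasDerivAt
    have hSd := ((contDiffAt_profile_of_radialScalar hS hζ).differentiableAt (by simp)).hasDerivAt
    exact profileEq_soundSpeed_of_ne_zero hz hUd hSd (hode ‖z‖ hζ).2
  have hRz : R = 0 := by
    haveI : NeBot (𝓝[≠] (0 : V3)) := Module.punctured_nhds_neBot ℝ V3 0
    exact Continuous.ext_on (dense_compl_singleton 0) hcont continuous_const fun z hz => hzero z hz
  exact congrFun hRz y

end Profile

/-! ### The self-similar change of variables turns a stationary profile into an exact solution -/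

section Ansatz

/-- Module algebra of the momentum equation under the ansatz: with `a′ = (r−1)κ`, `a e′ = κ e`,
`a² e = κ`, the physical residual is `κ` times the profile residual. [folklore] -/
theorem ss_momentum_algebra (L : V3 →L[ℝ] V3) (Ub g x : V3) {Sb r a a' e e' κ : ℝ}
    (h1 : a' = (r - 1) * κ) (h2 : a * e' = κ * e) (h3 : a * a * e = κ) :
    a • L (e' • x) + a' • Ub + (a • (e • L)) (a • Ub) + (1 / 3 * (a * Sb)) • ((a * e) • g) =
      κ • ((r - 1) • Ub + L (e • x + Ub) + (1 / 3 * Sb) • g) := by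
  rw [← sub_eq_zero]
  have key : a • L (e' • x) + a' • Ub + (a • (e • L)) (a • Ub) + (1 / 3 * (a * Sb)) • ((a * e) • g) -
      κ • ((r - 1) • Ub + L (e • x + Ub) + (1 / 3 * Sb) • g) =
      (a' - (r - 1) * κ) • Ub + (a * e' - κ * e) • L x +
        (a * a * e - κ) • (L Ub + (1 / 3 * Sb) • g) := by
    simp only [map_add, map_smul, FunLike.coe_smul, Pi.smul_apply]
    module
  rw [key, h1, h2, h3]
  simp

/-- Scalar algebra of the sound-speed equation under the ansatz. [folklore] -/
theorem ss_soundSpeed_algebra {ℓx ℓU Sb tr r a a' e e' κ : ℝ}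
    (h1 : a' = (r - 1) * κ) (h2 : a * e' = κ * e) (h3 : a * a * e = κ) :
    a * (e' * ℓx) + a' * Sb + a * e * (a * ℓU) + 1 / 3 * (a * Sb) * (a * e * tr) =
      κ * ((r - 1) * Sb + (e * ℓx + ℓU) + 1 / 3 * Sb * tr) := by
  rw [h1]
  linear_combination ℓx * h2 + (ℓU + 1 / 3 * Sb * tr) * h3

variable {r T : ℝ} {Ub : V3 → V3} {Sb : V3 → ℝ} {u : ℝ → V3 → V3} {σ : ℝ → V3 → ℝ}

/-- **The self-similar change of variables with a stationary profile solves the `(u, σ)`-system.**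
Let `(Ū, S̄)` be `C¹` fields on `ℝ³` solving the profile equations (`α = 1/3`) pointwise, and put
`u(x,t) = r⁻¹(T−t)^{1/r−1} Ū(x/(T−t)^{1/r})`, `σ(x,t) = r⁻¹(T−t)^{1/r−1} S̄(x/(T−t)^{1/r})`. Then for
`t < T`: `∂ₜu + (u·∇)u + ⅓ σ∇σ = 0` and `∂ₜσ + u·∇σ + ⅓ σ div u = 0` (the `(u, σ)` form of the
isentropic Euler equations, `ν = 0`, p. 5 of the source; also recorded: the explicit time and space
derivatives of `u` and `σ`).
[cite: CaolaboraEtAl2025, §1.3 p. 5: equations for `(u, σ)`, self-similar change of variables, profile equations] -/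
theorem uσ_system_of_ansatz (hr : r ≠ 0) (hUb : ContDiff ℝ 1 Ub) (hSb : ContDiff ℝ 1 Sb)
    (hP1 : ∀ y, (r - 1) • Ub y + fderiv ℝ Ub y (y + Ub y) + (1 / 3 * Sb y) • gradient Sb y = 0)
    (hP2 : ∀ y, (r - 1) * Sb y + fderiv ℝ Sb y (y + Ub y) +
      1 / 3 * Sb y * ∑ i, (fderiv ℝ Ub y (EuclideanSpace.single i 1)) i = 0)
    (hu : ∀ t x, u t x = (r⁻¹ * (T - t) ^ (1 / r - 1)) • Ub ((T - t) ^ (-1 / r) • x))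
    (hσ : ∀ t x, σ t x = (r⁻¹ * (T - t) ^ (1 / r - 1)) * Sb ((T - t) ^ (-1 / r) • x))
    {t : ℝ} (ht : t < T) (x : V3) :
    HasDerivAt (fun τ => u τ x)
        ((r⁻¹ * (T - t) ^ (1 / r - 1)) •
            fderiv ℝ Ub ((T - t) ^ (-1 / r) • x) ((r⁻¹ * (T - t) ^ (-1 / r - 1)) • x) +
          ((r - 1) * (r⁻¹ ^ 2 * (T - t) ^ (1 / r - 2))) • Ub ((T - t) ^ (-1 / r) • x)) t ∧
      HasFDerivAt (u t) ((r⁻¹ * (T - t) ^ (1 / r - 1)) •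
          ((T - t) ^ (-1 / r) • fderiv ℝ Ub ((T - t) ^ (-1 / r) • x))) x ∧
      HasDerivAt (fun τ => σ τ x)
        ((r⁻¹ * (T - t) ^ (1 / r - 1)) *
            fderiv ℝ Sb ((T - t) ^ (-1 / r) • x) ((r⁻¹ * (T - t) ^ (-1 / r - 1)) • x) +
          ((r - 1) * (r⁻¹ ^ 2 * (T - t) ^ (1 / r - 2))) * Sb ((T - t) ^ (-1 / r) • x)) t ∧
      HasFDerivAt (σ t) ((r⁻¹ * (T - t) ^ (1 / r - 1)) •
          ((T - t) ^ (-1 / r) • fderiv ℝ Sb ((T - t) ^ (-1 / r) • x))) x ∧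
      deriv (fun τ => u τ x) t + fderiv ℝ (u t) x (u t x) +
          (1 / 3 * σ t x) • gradient (σ t) x = 0 ∧
      deriv (fun τ => σ τ x) t + fderiv ℝ (σ t) x (u t x) +
          1 / 3 * σ t x * ∑ i, (fderiv ℝ (u t) x (EuclideanSpace.single i 1)) i = 0 := by
  -- notation: `a` amplitude, `e` scale, `y = e • x`, `L = DŪ(y)`, `ℓ = DS̄(y)`
  set l : ℝ := T - t with hl
  have hl0 : 0 < l := sub_pos.mpr ht
  set a : ℝ := r⁻¹ * l ^ (1 / r - 1) with ha
  set a' : ℝ := (r - 1) * (r⁻¹ ^ 2 * l ^ (1 / r - 2)) with ha'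
  set e : ℝ := l ^ (-1 / r) with he
  set e' : ℝ := r⁻¹ * l ^ (-1 / r - 1) with he'
  set κ : ℝ := r⁻¹ ^ 2 * l ^ (1 / r - 2) with hκ
  set y : V3 := e • x with hy
  set L : V3 →L[ℝ] V3 := fderiv ℝ Ub y with hL
  set ℓ : V3 →L[ℝ] ℝ := fderiv ℝ Sb y with hℓ
  have hLd : HasFDerivAt Ub L y := (hUb.differentiable one_ne_zero y).hasFDerivAt
  have hℓd : HasFDerivAt Sb ℓ y := (hSb.differentiable one_ne_zero y).hasFDerivAt
  -- the three scalar identities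
  have h1 : a' = (r - 1) * κ := rfl
  have h2 : a * e' = κ * e := ssAmplitude_mul_dScale hl0
  have h3 : a * a * e = κ := by rw [← sq]; exact ssAmplitude_sq_mul_scale hl0
  -- time derivatives of amplitude and scale
  have hadt : HasDerivAt (fun τ => r⁻¹ * (T - τ) ^ (1 / r - 1)) a' t := hasDerivAt_ssAmplitude hr ht
  have hedt : HasDerivAt (fun τ => (T - τ) ^ (-1 / r)) e' t := hasDerivAt_ssScale ht
  -- u
  have hu_fun : u = fun τ z => (r⁻¹ * (T - τ) ^ (1 / r - 1)) • Ub ((T - τ) ^ (-1 / r) • z) := by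
    funext τ z; exact hu τ z
  have hσ_fun : σ = fun τ z => (r⁻¹ * (T - τ) ^ (1 / r - 1)) * Sb ((T - τ) ^ (-1 / r) • z) := by
    funext τ z; exact hσ τ z
  have hut : HasDerivAt (fun τ => u τ x) (a • L (e' • x) + a' • Ub y) t := by
    rw [hu_fun]
    have hin : HasDerivAt (fun τ => (T - τ) ^ (-1 / r) • x) (e' • x) t := hedt.smul_const x
    have hcomp : HasDerivAt (fun τ => Ub ((T - τ) ^ (-1 / r) • x)) (L (e' • x)) t :=
      hLd.comp_hasDerivAt t hin
    exact hadt.fun_smul hcomp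
  have hux : HasFDerivAt (u t) (a • (e • L)) x := by
    rw [hu_fun]
    have hin : HasFDerivAt (fun z : V3 => (T - t) ^ (-1 / r) • z)
        (e • ContinuousLinearMap.id ℝ V3) x :=
      (hasFDerivAt_id x).fun_const_smul e
    have hcomp : HasFDerivAt (fun z : V3 => Ub ((T - t) ^ (-1 / r) • z)) (e • L) x := by
      refine (hLd.comp x hin).congr_fderiv ?_
      ext v
      simp
    exact hcomp.const_smul a
  have hσt : HasDerivAt (fun τ => σ τ x) (a * ℓ (e' • x) + a' * Sb y) t := by
    rw [hσ_fun]
    have hin : HasDerivAt (fun τ => (T - τ) ^ (-1 / r) • x) (e' • x) t := hedt.smul_const x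
    have hcomp : HasDerivAt (fun τ => Sb ((T - τ) ^ (-1 / r) • x)) (ℓ (e' • x)) t :=
      hℓd.comp_hasDerivAt t hin
    exact (hadt.fun_mul hcomp).congr_deriv (by rw [add_comm])
  have hσx : HasFDerivAt (σ t) (a • (e • ℓ)) x := by
    rw [hσ_fun]
    have hin : HasFDerivAt (fun z : V3 => (T - t) ^ (-1 / r) • z)
        (e • ContinuousLinearMap.id ℝ V3) x :=
      (hasFDerivAt_id x).fun_const_smul e
    have hcomp : HasFDerivAt (fun z : V3 => Sb ((T - t) ^ (-1 / r) • z)) (e • ℓ) x := by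
      refine (hℓd.comp x hin).congr_fderiv ?_
      ext v
      simp
    exact hcomp.const_smul a
  have hgrad : gradient (σ t) x = (a * e) • gradient Sb y := by
    change (toDual ℝ V3).symm (fderiv ℝ (σ t) x) = (a * e) • (toDual ℝ V3).symm (fderiv ℝ Sb y)
    rw [hσx.fderiv, smul_smul, map_smulₛₗ, starRingEnd_apply, star_trivial]
  have hu' : u t x = a • Ub y := hu t x
  have hσ' : σ t x = a * Sb y := hσ t x
  have hℓy : ℓ y = e * ℓ x := by rw [hy, map_smul, smul_eq_mul]
  refine ⟨hut, hux, hσt, hσx, ?_, ?_⟩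
  · -- momentum
    rw [hut.deriv, hux.fderiv, hgrad, hu', hσ', ss_momentum_algebra L (Ub y) (gradient Sb y) x h1 h2 h3]
    have hP := hP1 y
    rw [← hL] at hP
    rw [hy] at hP ⊢
    rw [hP, smul_zero]
  · -- sound speed
    have htr : ∑ i, ((a • (e • L)) (EuclideanSpace.single i 1)) i =
        a * e * ∑ i, (L (EuclideanSpace.single i 1)) i := by
      rw [Finset.mul_sum]
      refine Finset.sum_congr rfl fun i _ => ?_
      simp only [FunLike.coe_smul, Pi.smul_apply, PiLp.smul_apply, smul_eq_mul]
      ring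
    rw [hσt.deriv, hσx.fderiv, hux.fderiv, hu', hσ', htr]
    simp only [map_smul, FunLike.coe_smul, Pi.smul_apply, smul_eq_mul]
    have hP := hP2 y
    rw [← hL, ← hℓ, map_add, hℓy] at hP
    linear_combination κ * hP + ℓ x * h2 +
      (ℓ (Ub y) + 1 / 3 * Sb y * ∑ i, (L (EuclideanSpace.single i 1)) i) * h3 + Sb y * h1

end Ansatz

/-! ### From the `(u, σ)`-system back to the density: `ρ = (σ/3)³` (`σ = 3ρ^{1/3}`, `α = 1/3`) -/

section Density

/-- For `c > 0`, `(c³)^{5/3} = c⁵` (real power). [folklore] -/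
theorem cube_rpow_five_thirds {c : ℝ} (hc : 0 < c) : (c ^ 3) ^ (5 / 3 : ℝ) = c ^ 5 := by
  rw [← Real.rpow_natCast c 3, ← Real.rpow_mul hc.le, ← Real.rpow_natCast c 5]
  norm_num

/-- For `c > 0`, `(c³)^{1/3} = c` (real power). [folklore] -/
theorem cube_rpow_third {c : ℝ} (hc : 0 < c) : (c ^ 3) ^ (1 / 3 : ℝ) = c := by
  rw [← Real.rpow_natCast c 3, ← Real.rpow_mul hc.le]
  norm_num

variable {u : ℝ → V3 → V3} {σ ρ : ℝ → V3 → ℝ} {t : ℝ} {x : V3}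
  {ut : V3} {Lu : V3 →L[ℝ] V3} {σt : ℝ} {ℓσ : V3 →L[ℝ] ℝ}

/-- **The `(u, σ)` form is the isentropic Euler system.** At a point `(t, x)`: if `u`, `σ > 0` are
differentiable there with `∂ₜu + (u·∇)u + ⅓σ∇σ = 0`, `∂ₜσ + u·∇σ + ⅓σ div u = 0`, and
`ρ = (σ/3)³` (i.e. `σ = α⁻¹ρ^α`, `α = (γ−1)/2 = 1/3`, `γ = 5/3`), then
`∂ₜρ + ∑ᵢ ∂ᵢ(ρuᵢ) = 0` and `ρ∂ₜu + ρ∑ᵢ uᵢ∂ᵢu + ∇(ρ^γ/γ) = 0` (eq. (1.1) with `ν = 0`; the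
computation displayed at the start of §1.3, read backwards).
[cite: CaolaboraEtAl2025, eq. (1.1) p. 3 (ν = 0); §1.3 p. 5, first display] -/
theorem euler_of_uσ (hut : HasDerivAt (fun τ => u τ x) ut t) (hux : HasFDerivAt (u t) Lu x)
    (hσt : HasDerivAt (fun τ => σ τ x) σt t) (hσx : HasFDerivAt (σ t) ℓσ x)
    (hρ : ∀ τ z, ρ τ z = (σ τ z / 3) ^ 3) (hpos : ∀ z, 0 < σ t z)
    (hM : ut + Lu (u t x) + (1 / 3 * σ t x) • gradient (σ t) x = 0)
    (hZ : σt + ℓσ (u t x) + 1 / 3 * σ t x * ∑ i, (Lu (EuclideanSpace.single i 1)) i = 0) :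
    deriv (fun τ => ρ τ x) t +
        ∑ i, fderiv ℝ (fun z => ρ t z * u t z i) x (EuclideanSpace.single i 1) = 0 ∧
      ρ t x • deriv (fun τ => u τ x) t +
          ρ t x • ∑ i, u t x i • fderiv ℝ (u t) x (EuclideanSpace.single i 1) +
        gradient (fun z => ρ t z ^ (5 / 3 : ℝ) / (5 / 3)) x = 0 := by
  -- derivatives of `ρ = (σ/3)³`
  have hρt : HasDerivAt (fun τ => ρ τ x) (↑(3 : ℕ) * (σ t x / 3) ^ (3 - 1) * (σt / 3)) t := by
    have h := (hσt.div_const 3).fun_pow 3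
    refine h.congr_of_eventuallyEq (Eventually.of_forall fun τ => hρ τ x)
  have hρx : HasFDerivAt (ρ t) (((σ t x / 3) ^ 2) • ℓσ) x := by
    have h := (hσx.mul_const (1 / 3 : ℝ)).pow 3
    have hfun : (fun z => (σ t z * (1 / 3)) ^ 3) = ρ t := by
      funext z; rw [hρ t z]; ring
    rw [hfun] at h
    refine h.congr_fderiv ?_
    ext v
    simp only [FunLike.coe_smul, Pi.smul_apply, smul_eq_mul, nsmul_eq_mul, Nat.cast_ofNat]
    ring
  -- coordinates: `u = ∑ᵢ uᵢ eᵢ`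
  have hbasis : ∑ i, u t x i • EuclideanSpace.single i (1 : ℝ) = u t x := by
    simpa only [EuclideanSpace.basisFun_repr, EuclideanSpace.basisFun_apply] using
      (EuclideanSpace.basisFun (Fin 3) ℝ).sum_repr (u t x)
  -- components of `u`
  have hui : ∀ i : Fin 3, HasFDerivAt (fun z => u t z i)
      ((PiLp.proj 2 (fun _ : Fin 3 => ℝ) i).comp Lu) x := fun i => by
    have h := (PiLp.proj (𝕜 := ℝ) 2 (fun _ : Fin 3 => ℝ) i).hasFDerivAt.comp x hux
    exact h
  have hflux : ∀ i : Fin 3, fderiv ℝ (fun z => ρ t z * u t z i) x (EuclideanSpace.single i 1) =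
      ρ t x * (Lu (EuclideanSpace.single i 1)) i +
        u t x i * ((σ t x / 3) ^ 2 * ℓσ (EuclideanSpace.single i 1)) := by
    intro i
    rw [(hρx.fun_mul (hui i)).fderiv]
    simp only [add_apply, FunLike.coe_smul, Pi.smul_apply, smul_eq_mul,
      ContinuousLinearMap.coe_comp, Function.comp_apply, PiLp.proj_apply]
  constructor
  · -- mass
    rw [hρt.deriv, Finset.sum_congr rfl fun i _ => hflux i, Finset.sum_add_distrib,
      ← Finset.mul_sum]
    have hsum : ∑ i, u t x i * ((σ t x / 3) ^ 2 * ℓσ (EuclideanSpace.single i 1)) =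
        (σ t x / 3) ^ 2 * ℓσ (u t x) := by
      have : ℓσ (u t x) = ∑ i, u t x i * ℓσ (EuclideanSpace.single i 1) := by
        conv_lhs => rw [← hbasis]
        rw [map_sum]
        exact Finset.sum_congr rfl fun i _ => by rw [map_smul, smul_eq_mul]
      rw [this, Finset.mul_sum]
      exact Finset.sum_congr rfl fun i _ => by ring
    rw [hsum, hρ t x]
    simp only [Nat.cast_ofNat]
    linear_combination (σ t x / 3) ^ 2 * hZ
  · -- momentum
    have hconv : ∑ i, u t x i • fderiv ℝ (u t) x (EuclideanSpace.single i 1) = Lu (u t x) := by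
      rw [hux.fderiv]
      conv_rhs => rw [← hbasis]
      rw [map_sum]
      exact Finset.sum_congr rfl fun i _ => by rw [map_smul]
    -- the pressure `ρ^γ/γ = (σ/3)⁵ · 3/5`
    have hPfun : (fun z => ρ t z ^ (5 / 3 : ℝ) / (5 / 3)) = fun z => (σ t z * (1 / 3)) ^ 5 * (3 / 5) := by
      funext z
      rw [hρ t z, cube_rpow_five_thirds (by have := hpos z; positivity)]
      ring
    have hPx : HasFDerivAt (fun z => ρ t z ^ (5 / 3 : ℝ) / (5 / 3)) (((σ t x / 3) ^ 4) • ℓσ) x := by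
      rw [hPfun]
      refine (((hσx.mul_const (1 / 3 : ℝ)).pow 5).mul_const (3 / 5 : ℝ)).congr_fderiv ?_
      ext v
      simp only [FunLike.coe_smul, Pi.smul_apply, smul_eq_mul, nsmul_eq_mul, Nat.cast_ofNat]
      ring
    have hgradP : gradient (fun z => ρ t z ^ (5 / 3 : ℝ) / (5 / 3)) x =
        ((σ t x / 3) ^ 4) • gradient (σ t) x := by
      change (toDual ℝ V3).symm (fderiv ℝ (fun z => ρ t z ^ (5 / 3 : ℝ) / (5 / 3)) x) =
        ((σ t x / 3) ^ 4) • (toDual ℝ V3).symm (fderiv ℝ (σ t) x)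
      rw [hPx.fderiv, hσx.fderiv, map_smulₛₗ, starRingEnd_apply, star_trivial]
    rw [hut.deriv, hconv, hgradP, hρ t x]
    have key : (σ t x / 3) ^ 3 • ut + (σ t x / 3) ^ 3 • Lu (u t x) +
        ((σ t x / 3) ^ 4) • gradient (σ t) x =
        (σ t x / 3) ^ 3 • (ut + Lu (u t x) + (1 / 3 * σ t x) • gradient (σ t) x) := by
      module
    rw [key, hM, smul_zero]

end Density

/-! ### The exact self-similar implosion on `ℝ³` -/

section Main

variable {r T : ℝ} {U S : ℝ → ℝ} {Ub : V3 → V3} {Sb : V3 → ℝ} {u : ℝ → V3 → V3}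
  {σ ρ : ℝ → V3 → ℝ}

/-- **The exact self-similar implosion of the monatomic gas on `ℝ³` from a smooth profile.** Let
`(U, S)` be a profile as in `BuckmasterCaolaboraGomezserrano2025_thm11_monatomic`: the radial fields
`Ū(y) = U(|y|) y/|y|`, `S̄(y) = S(|y|)` are smooth on `ℝ³`, the radial profile equations hold for
`ζ > 0`, and `S > 0` on `[0, ∞)`; let `r > 0` and `T ∈ ℝ`. Then the self-similar ansatz of §1.3,
`u(x,t) = r⁻¹(T−t)^{1/r−1} Ū(x/(T−t)^{1/r})`, `σ(x,t) = r⁻¹(T−t)^{1/r−1} S̄(x/(T−t)^{1/r})`,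
`ρ = (σ/3)³` (`σ = α⁻¹ρ^α`, `α = 1/3`), defines a classical solution of the isentropic compressible
Euler equations (1.1) (`ν = 0`, `γ = 5/3`) on `(−∞, T) × ℝ³`: `ρ, u` are jointly `C^∞` there,
`ρ > 0`, `∂ₜρ + ∑ᵢ∂ᵢ(ρuᵢ) = 0`, `ρ∂ₜu + ρ∑ᵢuᵢ∂ᵢu + ∇(ρ^{5/3}/(5/3)) = 0`; its central density is
EXACTLY `ρ(t,0) = (S(0)/(3r))³ (T−t)^{−3(1−1/r)}` (so it implodes at time `T` when `r > 1`), and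
its first derivatives obey the Type-I identities `∇u(t,x) = (r(T−t))⁻¹ ∇Ū(y)`,
`∇(ρ^{1/3})(t,x) = ⅓(r(T−t))⁻¹ ∇S̄(y)`, `y = x/(T−t)^{1/r}`. This is the last sentence of Thm 1.1
of Buckmaster–Cao-Labora–Gómez-Serrano, p. 4 ("This gives a smooth and radially symmetric
self-similar solution to [the radial isentropic Euler equations] of the form [of the self-similar
ansatz]"), written in the notation of §1.3 of Cao-Labora–Gómez-Serrano–Shi–Staffilani.
[cite: BuckmasterCaolaboraGomezserrano2025, Thm 1.1 p. 4] [cite: CaolaboraEtAl2025, eq. (1.1) p. 3; §1.3 p. 5] -/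
theorem exactSolution_of_profile (hr : 0 < r)
    (hU : ContDiff ℝ ∞ fun y : V3 => (U ‖y‖ / ‖y‖) • y) (hS : ContDiff ℝ ∞ fun y : V3 => S ‖y‖)
    (hode : ∀ ζ : ℝ, 0 < ζ →
      (r - 1) * U ζ + (ζ + U ζ) * deriv U ζ + 1 / 3 * S ζ * deriv S ζ = 0 ∧
      (r - 1) * S ζ + (ζ + U ζ) * deriv S ζ + 1 / 3 * S ζ * (deriv U ζ + 2 * U ζ / ζ) = 0)
    (hSpos : ∀ ζ : ℝ, 0 ≤ ζ → 0 < S ζ)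
    (hUb : Ub = fun y : V3 => (U ‖y‖ / ‖y‖) • y) (hSb : Sb = fun y : V3 => S ‖y‖)
    (hu : ∀ t x, u t x = (r⁻¹ * (T - t) ^ (1 / r - 1)) • Ub ((T - t) ^ (-1 / r) • x))
    (hσ : ∀ t x, σ t x = (r⁻¹ * (T - t) ^ (1 / r - 1)) * Sb ((T - t) ^ (-1 / r) • x))
    (hρ : ∀ t x, ρ t x = (σ t x / 3) ^ 3) :
    ContDiffOn ℝ ∞ (fun p : ℝ × V3 => ρ p.1 p.2) {p | p.1 < T} ∧
    ContDiffOn ℝ ∞ (fun p : ℝ × V3 => u p.1 p.2) {p | p.1 < T} ∧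
    (∀ t < T, ∀ x, 0 < ρ t x) ∧
    (∀ t < T, ∀ x, deriv (fun τ => ρ τ x) t +
        ∑ i, fderiv ℝ (fun z => ρ t z * u t z i) x (EuclideanSpace.single i 1) = 0) ∧
    (∀ t < T, ∀ x, ρ t x • deriv (fun τ => u τ x) t +
          ρ t x • ∑ i, u t x i • fderiv ℝ (u t) x (EuclideanSpace.single i 1) +
        gradient (fun z => ρ t z ^ (5 / 3 : ℝ) / (5 / 3)) x = 0) ∧
    (∀ t < T, ρ t 0 = (S 0 / (3 * r)) ^ 3 * (T - t) ^ (-(3 * (1 - 1 / r)))) ∧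
    (∀ t < T, ∀ x, fderiv ℝ (u t) x = (r⁻¹ * (T - t)⁻¹) • fderiv ℝ Ub ((T - t) ^ (-1 / r) • x) ∧
      fderiv ℝ (fun z => ρ t z ^ (1 / 3 : ℝ)) x =
        (1 / 3 * (r⁻¹ * (T - t)⁻¹)) • fderiv ℝ Sb ((T - t) ^ (-1 / r) • x)) := by
  have hr0 : r ≠ 0 := hr.ne'
  have hUb1 : ContDiff ℝ 1 Ub := hUb ▸ hU.of_le (by norm_cast)
  have hSb1 : ContDiff ℝ 1 Sb := hSb ▸ hS.of_le (by norm_cast)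
  have hP1 : ∀ y, (r - 1) • Ub y + fderiv ℝ Ub y (y + Ub y) + (1 / 3 * Sb y) • gradient Sb y = 0 := by
    subst hUb hSb; exact profileEq_velocity hU hS hode
  have hP2 : ∀ y, (r - 1) * Sb y + fderiv ℝ Sb y (y + Ub y) +
      1 / 3 * Sb y * ∑ i, (fderiv ℝ Ub y (EuclideanSpace.single i 1)) i = 0 := by
    subst hUb hSb; exact profileEq_soundSpeed hU hS hode
  -- positivity of `σ`
  have hσpos : ∀ t < T, ∀ x, 0 < σ t x := by
    intro t ht x
    rw [hσ, hSb]
    exact mul_pos (mul_pos (inv_pos.mpr hr) (Real.rpow_pos_of_pos (sub_pos.mpr ht) _))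
      (hSpos _ (norm_nonneg _))
  -- joint smoothness
  have hsm : ContDiffOn ℝ ∞ (fun p : ℝ × V3 => σ p.1 p.2) {p | p.1 < T} ∧
      ContDiffOn ℝ ∞ (fun p : ℝ × V3 => u p.1 p.2) {p | p.1 < T} := by
    have hl : ContDiffOn ℝ ∞ (fun p : ℝ × V3 => T - p.1) {p | p.1 < T} :=
      (contDiff_const.sub contDiff_fst).contDiffOn
    have hl0 : ∀ p ∈ {p : ℝ × V3 | p.1 < T}, T - p.1 ≠ 0 := fun p hp => (sub_pos.mpr hp).ne'
    have hamp : ContDiffOn ℝ ∞ (fun p : ℝ × V3 => r⁻¹ * (T - p.1) ^ (1 / r - 1)) {p | p.1 < T} :=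
      contDiffOn_const.mul (hl.rpow_const_of_ne hl0)
    have hy : ContDiffOn ℝ ∞ (fun p : ℝ × V3 => (T - p.1) ^ (-1 / r) • p.2) {p | p.1 < T} :=
      (hl.rpow_const_of_ne hl0).smul contDiff_snd.contDiffOn
    have hU' : ContDiffOn ℝ ∞ (fun p : ℝ × V3 => Ub ((T - p.1) ^ (-1 / r) • p.2)) {p | p.1 < T} :=
      (hUb ▸ hU).comp_contDiffOn hy
    have hS' : ContDiffOn ℝ ∞ (fun p : ℝ × V3 => Sb ((T - p.1) ^ (-1 / r) • p.2)) {p | p.1 < T} :=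
      (hSb ▸ hS).comp_contDiffOn hy
    refine ⟨(hamp.mul hS').congr fun p _ => hσ p.1 p.2, (hamp.smul hU').congr fun p _ => hu p.1 p.2⟩
  refine ⟨?_, hsm.2, ?_, ?_, ?_, ?_, ?_⟩
  · -- smoothness of `ρ = (σ/3)³`
    exact ((hsm.1.div_const 3).pow 3).congr fun p _ => hρ p.1 p.2
  · -- positivity of `ρ`
    intro t ht x
    rw [hρ]
    exact pow_pos (div_pos (hσpos t ht x) three_pos) 3
  · -- mass
    intro t ht x
    obtain ⟨hut, hux, hσt, hσx, hM, hZ⟩ := uσ_system_of_ansatz hr0 hUb1 hSb1 hP1 hP2 hu hσ ht x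
    rw [hut.deriv, hux.fderiv] at hM
    rw [hσt.deriv, hσx.fderiv, hux.fderiv] at hZ
    exact (euler_of_uσ hut hux hσt hσx hρ (hσpos t ht) hM hZ).1
  · -- momentum
    intro t ht x
    obtain ⟨hut, hux, hσt, hσx, hM, hZ⟩ := uσ_system_of_ansatz hr0 hUb1 hSb1 hP1 hP2 hu hσ ht x
    rw [hut.deriv, hux.fderiv] at hM
    rw [hσt.deriv, hσx.fderiv, hux.fderiv] at hZ
    exact (euler_of_uσ hut hux hσt hσx hρ (hσpos t ht) hM hZ).2
  · -- the central density
    intro t ht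
    have hl0 : 0 < T - t := sub_pos.mpr ht
    simp only [hρ, hσ, hSb, smul_zero, norm_zero]
    rw [show -(3 * (1 - 1 / r)) = (1 / r - 1) * ((3 : ℕ) : ℝ) by push_cast; ring,
      Real.rpow_mul hl0.le, Real.rpow_natCast]
    ring
  · -- Type-I identities
    intro t ht x
    have hl0 : 0 < T - t := sub_pos.mpr ht
    obtain ⟨-, hux, -, hσx, -, -⟩ := uσ_system_of_ansatz hr0 hUb1 hSb1 hP1 hP2 hu hσ ht x
    have hae : r⁻¹ * (T - t) ^ (1 / r - 1) * (T - t) ^ (-1 / r) = r⁻¹ * (T - t)⁻¹ :=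
      ssAmplitude_mul_scale hl0
    refine ⟨by rw [hux.fderiv, smul_smul, hae], ?_⟩
    -- `ρ^{1/3} = σ/3`
    have hcbrt : (fun z => ρ t z ^ (1 / 3 : ℝ)) = fun z => σ t z * (1 / 3) := by
      funext z
      rw [hρ, cube_rpow_third (div_pos (hσpos t ht z) three_pos)]
      ring
    rw [hcbrt, (hσx.mul_const (1 / 3 : ℝ)).fderiv, smul_smul, smul_smul, mul_assoc (1 / 3 : ℝ), hae]

/-- **Exact self-similar implosion for the monatomic gas on `ℝ³` (Buckmaster–Cao-Labora–Gómez-Serrano,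
Thm 1.1 at `γ = 5/3`, last sentence), from the vendored profile fact.** There is a self-similar
exponent `r` in the window `(1.10102, 1.13476)` such that for every blow-up time `T` the isentropic
compressible Euler equations with `p = ρ^{5/3}/(5/3)` have a classical solution `(ρ, u)` on
`(−∞, T) × ℝ³`, jointly `C^∞`, with `ρ > 0`, whose central density is
`ρ(t, 0) = c (T−t)^{−3(1−1/r)}`, `c > 0` — in particular `ρ(t,0) → ∞` as `t → T⁻` (`r > 1`).
[cite: BuckmasterCaolaboraGomezserrano2025, Thm 1.1 p. 4] [cite: CaolaboraEtAl2025, eq. (1.1) p. 3; §1.3 p. 5] -/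
theorem exact_selfSimilar_implosion_of_thm11_monatomic
    (hX : BuckmasterCaolaboraGomezserrano2025_thm11_monatomic) :
    ∃ r : ℝ, 1.10102 < r ∧ r < 1.13476 ∧ ∀ T : ℝ, ∃ (ρ : ℝ → V3 → ℝ) (u : ℝ → V3 → V3),
      ContDiffOn ℝ ∞ (fun p : ℝ × V3 => ρ p.1 p.2) {p | p.1 < T} ∧
      ContDiffOn ℝ ∞ (fun p : ℝ × V3 => u p.1 p.2) {p | p.1 < T} ∧
      (∀ t < T, ∀ x, 0 < ρ t x) ∧
      (∀ t < T, ∀ x, deriv (fun τ => ρ τ x) t +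
          ∑ i, fderiv ℝ (fun z => ρ t z * u t z i) x (EuclideanSpace.single i 1) = 0) ∧
      (∀ t < T, ∀ x, ρ t x • deriv (fun τ => u τ x) t +
            ρ t x • ∑ i, u t x i • fderiv ℝ (u t) x (EuclideanSpace.single i 1) +
          gradient (fun z => ρ t z ^ (5 / 3 : ℝ) / (5 / 3)) x = 0) ∧
      ∃ c : ℝ, 0 < c ∧ ∀ t < T, ρ t 0 = c * (T - t) ^ (-(3 * (1 - 1 / r))) := by
  obtain ⟨r, hr1, hr2, U, S, hU, hS, hode, hpos, -, -⟩ := hX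
  have hr : 0 < r := by linarith
  refine ⟨r, hr1, hr2, fun T => ?_⟩
  set Ub : V3 → V3 := fun y => (U ‖y‖ / ‖y‖) • y with hUb
  set Sb : V3 → ℝ := fun y => S ‖y‖ with hSb
  set u : ℝ → V3 → V3 := fun t x => (r⁻¹ * (T - t) ^ (1 / r - 1)) • Ub ((T - t) ^ (-1 / r) • x)
    with hu
  set σ : ℝ → V3 → ℝ := fun t x => (r⁻¹ * (T - t) ^ (1 / r - 1)) * Sb ((T - t) ^ (-1 / r) • x)
    with hσ
  set ρ : ℝ → V3 → ℝ := fun t x => (σ t x / 3) ^ 3 with hρ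
  obtain ⟨h1, h2, h3, h4, h5, h6, -⟩ := exactSolution_of_profile (T := T) (u := u) (σ := σ) (ρ := ρ)
    hr hU hS hode hpos hUb hSb (fun _ _ => rfl) (fun _ _ => rfl) (fun _ _ => rfl)
  refine ⟨ρ, u, h1, h2, h3, h4, h5, (S 0 / (3 * r)) ^ 3, ?_, h6⟩
  exact pow_pos (div_pos (hpos 0 le_rfl) (by positivity)) 3

end Main

/-! ### Decay of the profile derivatives and the Type-I bounds -/

section Decay

variable {r : ℝ} {U S : ℝ → ℝ}

/-- **The profile derivatives vanish at infinity.** For profiles solving the radial profile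
equations for `ζ > 0` and ending at `P_∞ = (0,0)` (`U/ζ → 0`, `S/ζ → 0`, as recorded in the
vendored fact), `U′(ζ) → 0` and `S′(ζ) → 0` as `ζ → ∞`: solve the `2 × 2` linear system for
`(U′, S′)`, whose determinant `(ζ+U)² − S²/9 ∼ ζ²`. (The source records the stronger decay
`|∇ʲŪ| + |∇ʲS̄| ≲ ⟨R⟩^{−(r−1)−j}`, p. 6, from the phase-portrait analysis of BCG; only this
consequence of the end point `P_∞` is needed for the Type-I bounds.)
[cite: CaolaboraEtAl2025, §1.3 p. 5 (profile equations), p. 6 (decay of the profiles)] -/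
theorem tendsto_deriv_profile_atTop
    (hode : ∀ ζ : ℝ, 0 < ζ →
      (r - 1) * U ζ + (ζ + U ζ) * deriv U ζ + 1 / 3 * S ζ * deriv S ζ = 0 ∧
      (r - 1) * S ζ + (ζ + U ζ) * deriv S ζ + 1 / 3 * S ζ * (deriv U ζ + 2 * U ζ / ζ) = 0)
    (hlimU : Tendsto (fun ζ => U ζ / ζ) atTop (𝓝 0))
    (hlimS : Tendsto (fun ζ => S ζ / ζ) atTop (𝓝 0)) :
    Tendsto (deriv U) atTop (𝓝 0) ∧ Tendsto (deriv S) atTop (𝓝 0) := by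
  -- rescaled coefficients `p = U/ζ → 0`, `q = S/ζ → 0`
  set p : ℝ → ℝ := fun ζ => U ζ / ζ with hp
  set q : ℝ → ℝ := fun ζ => S ζ / ζ with hq
  set den : ℝ → ℝ := fun ζ => (1 + p ζ) ^ 2 - (q ζ / 3) ^ 2 with hden
  set numU : ℝ → ℝ := fun ζ =>
    (1 + p ζ) * (-(r - 1) * p ζ) - q ζ / 3 * (-(r - 1) * q ζ - 2 / 3 * q ζ * p ζ) with hnumU
  set numS : ℝ → ℝ := fun ζ =>
    (1 + p ζ) * (-(r - 1) * q ζ - 2 / 3 * q ζ * p ζ) - q ζ / 3 * (-(r - 1) * p ζ) with hnumS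
  have hden1 : Tendsto den atTop (𝓝 1) := by
    have h := ((tendsto_const_nhds (x := (1 : ℝ))).add hlimU).pow 2 |>.sub
      ((hlimS.div_const 3).pow 2)
    simpa using h
  have hnumU0 : Tendsto numU atTop (𝓝 0) := by
    have h := (((tendsto_const_nhds (x := (1 : ℝ))).add hlimU).mul (hlimU.const_mul (-(r - 1))))
      |>.sub ((hlimS.div_const 3).mul ((hlimS.const_mul (-(r - 1))).sub
        ((hlimS.const_mul (2 / 3)).mul hlimU)))
    show Tendsto (fun ζ => (1 + p ζ) * (-(r - 1) * p ζ) -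
      q ζ / 3 * (-(r - 1) * q ζ - 2 / 3 * q ζ * p ζ)) atTop (𝓝 0)
    simpa using h
  have hnumS0 : Tendsto numS atTop (𝓝 0) := by
    have h := (((tendsto_const_nhds (x := (1 : ℝ))).add hlimU).mul
      ((hlimS.const_mul (-(r - 1))).sub ((hlimS.const_mul (2 / 3)).mul hlimU)))
      |>.sub ((hlimS.div_const 3).mul (hlimU.const_mul (-(r - 1))))
    show Tendsto (fun ζ => (1 + p ζ) * (-(r - 1) * q ζ - 2 / 3 * q ζ * p ζ) -
      q ζ / 3 * (-(r - 1) * p ζ)) atTop (𝓝 0)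
    simpa using h
  -- eventually the determinant is nonzero and `U′ = numU/den`, `S′ = numS/den`
  have hev : ∀ᶠ ζ in atTop, deriv U ζ = numU ζ / den ζ ∧ deriv S ζ = numS ζ / den ζ := by
    filter_upwards [hden1.eventually_ne one_ne_zero, eventually_gt_atTop (0 : ℝ)] with ζ hdz hζ
    obtain ⟨h1, h2⟩ := hode ζ hζ
    have hζ0 : ζ ≠ 0 := hζ.ne'
    -- Cramer's rule for the `2 × 2` system
    have kU : ((ζ + U ζ) ^ 2 - (S ζ / 3) ^ 2) * deriv U ζ =
        (ζ + U ζ) * (-(r - 1) * U ζ) - S ζ / 3 * (-(r - 1) * S ζ - 2 / 3 * S ζ * U ζ / ζ) := by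
      linear_combination (ζ + U ζ) * h1 - S ζ / 3 * h2
    have kS : ((ζ + U ζ) ^ 2 - (S ζ / 3) ^ 2) * deriv S ζ =
        (ζ + U ζ) * (-(r - 1) * S ζ - 2 / 3 * S ζ * U ζ / ζ) - S ζ / 3 * (-(r - 1) * U ζ) := by
      linear_combination (ζ + U ζ) * h2 - S ζ / 3 * h1
    have hD : (ζ + U ζ) ^ 2 - (S ζ / 3) ^ 2 = ζ ^ 2 * den ζ := by
      simp only [hden, hp, hq]; field_simp
    have hNU : (ζ + U ζ) * (-(r - 1) * U ζ) - S ζ / 3 * (-(r - 1) * S ζ - 2 / 3 * S ζ * U ζ / ζ) =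
        ζ ^ 2 * numU ζ := by
      simp only [hnumU, hp, hq]; field_simp
    have hNS : (ζ + U ζ) * (-(r - 1) * S ζ - 2 / 3 * S ζ * U ζ / ζ) - S ζ / 3 * (-(r - 1) * U ζ) =
        ζ ^ 2 * numS ζ := by
      simp only [hnumS, hp, hq]; field_simp
    rw [hD, hNU] at kU
    rw [hD, hNS] at kS
    have hz2 : ζ ^ 2 ≠ 0 := pow_ne_zero 2 hζ0
    have kU' : den ζ * deriv U ζ = numU ζ :=
      mul_left_cancel₀ hz2 (by rw [← mul_assoc]; exact kU)
    have kS' : den ζ * deriv S ζ = numS ζ :=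
      mul_left_cancel₀ hz2 (by rw [← mul_assoc]; exact kS)
    constructor
    · rw [eq_div_iff hdz, mul_comm]; exact kU'
    · rw [eq_div_iff hdz, mul_comm]; exact kS'
  constructor
  · have h := hnumU0.div hden1 one_ne_zero
    rw [zero_div] at h
    exact h.congr' (hev.mono fun ζ hζ => hζ.1.symm)
  · have h := hnumS0.div hden1 one_ne_zero
    rw [zero_div] at h
    exact h.congr' (hev.mono fun ζ hζ => hζ.2.symm)

/-- Operator-norm bound for the derivative of a radial field at `y ≠ 0`:
`‖D(φ(|y|) y)‖ ≤ |φ| + |ζφ′|` with `ζφ′ = U′ − φ`, `φ = U/ζ`. [folklore] -/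
theorem norm_fderiv_radialField_le {y : V3} (hy : y ≠ 0) {U' : ℝ} (hUd : HasDerivAt U U' ‖y‖) :
    ‖fderiv ℝ (fun z : V3 => (U ‖z‖ / ‖z‖) • z) y‖ ≤
      2 * |U ‖y‖ / ‖y‖| + |U'| := by
  have hn : ‖y‖ ≠ 0 := norm_ne_zero_iff.2 hy
  have hnpos : 0 < ‖y‖ := norm_pos_iff.2 hy
  rw [(hasFDerivAt_radialField hy hUd).fderiv]
  refine (norm_add_le _ _).trans ?_
  have h1 : ‖(U ‖y‖ / ‖y‖) • ContinuousLinearMap.id ℝ V3‖ ≤ |U ‖y‖ / ‖y‖| := by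
    rw [norm_smul, Real.norm_eq_abs]
    exact mul_le_of_le_one_right (abs_nonneg _) ContinuousLinearMap.norm_id_le
  have h2 : ‖(((U' * ‖y‖ - U ‖y‖ * 1) / ‖y‖ ^ 2) • (‖y‖⁻¹ • innerSL ℝ y)).smulRight y‖ =
      |U' - U ‖y‖ / ‖y‖| := by
    rw [ContinuousLinearMap.norm_smulRight_apply, norm_smul, norm_smul, innerSL_apply_norm,
      Real.norm_eq_abs, Real.norm_eq_abs, abs_inv, abs_of_pos hnpos,
      show |(U' * ‖y‖ - U ‖y‖ * 1) / ‖y‖ ^ 2| * (‖y‖⁻¹ * ‖y‖) * ‖y‖ =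
        |(U' * ‖y‖ - U ‖y‖ * 1) / ‖y‖ ^ 2| * |‖y‖| by rw [abs_of_pos hnpos]; field_simp,
      ← abs_mul]
    congr 1
    field_simp
  rw [h2]
  have h3 : |U' - U ‖y‖ / ‖y‖| ≤ |U'| + |U ‖y‖ / ‖y‖| := abs_sub _ _
  linarith

/-- Operator norm of the derivative of a radial scalar field at `y ≠ 0`: `‖DS̄(y)‖ = |S′(|y|)|`.
[folklore] -/
theorem norm_fderiv_radialScalar {y : V3} (hy : y ≠ 0) {S' : ℝ} (hSd : HasDerivAt S S' ‖y‖) :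
    ‖fderiv ℝ (fun z : V3 => S ‖z‖) y‖ = |S'| := by
  have hnpos : 0 < ‖y‖ := norm_pos_iff.2 hy
  rw [(hasFDerivAt_radialScalar hy hSd).fderiv, norm_smul, norm_smul, innerSL_apply_norm,
    Real.norm_eq_abs, Real.norm_eq_abs, abs_inv, abs_of_pos hnpos, inv_mul_cancel₀ hnpos.ne',
    mul_one]

/-- **The profile fields have bounded derivatives on `ℝ³`** (smoothness on `ℝ³` bounds them on
balls; the end point `P_∞` bounds them at infinity). [cite: CaolaboraEtAl2025, p. 6 (decay of the profiles, `j = 1`)] -/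
theorem exists_bound_fderiv_profile
    (hU : ContDiff ℝ ∞ fun y : V3 => (U ‖y‖ / ‖y‖) • y) (hS : ContDiff ℝ ∞ fun y : V3 => S ‖y‖)
    (hode : ∀ ζ : ℝ, 0 < ζ →
      (r - 1) * U ζ + (ζ + U ζ) * deriv U ζ + 1 / 3 * S ζ * deriv S ζ = 0 ∧
      (r - 1) * S ζ + (ζ + U ζ) * deriv S ζ + 1 / 3 * S ζ * (deriv U ζ + 2 * U ζ / ζ) = 0)
    (hlimU : Tendsto (fun ζ => U ζ / ζ) atTop (𝓝 0))
    (hlimS : Tendsto (fun ζ => S ζ / ζ) atTop (𝓝 0)) :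
    ∃ M : ℝ, ∀ y : V3, ‖fderiv ℝ (fun z : V3 => (U ‖z‖ / ‖z‖) • z) y‖ ≤ M ∧
      ‖fderiv ℝ (fun z : V3 => S ‖z‖) y‖ ≤ M := by
  obtain ⟨hdU, hdS⟩ := tendsto_deriv_profile_atTop hode hlimU hlimS
  -- far field: `|U/ζ|, |U′|, |S′| < 1` for `ζ ≥ N`
  obtain ⟨N₁, hN₁⟩ := Metric.tendsto_atTop.1 hlimU 1 one_pos
  obtain ⟨N₂, hN₂⟩ := Metric.tendsto_atTop.1 hdU 1 one_pos
  obtain ⟨N₃, hN₃⟩ := Metric.tendsto_atTop.1 hdS 1 one_pos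
  set N : ℝ := max (max N₁ N₂) (max N₃ 1) with hN
  have hN1 : 1 ≤ N := le_max_of_le_right (le_max_right _ _)
  -- near field: continuity of the derivatives on the closed ball of radius `N`
  obtain ⟨C₁, hC₁⟩ := (isCompact_closedBall (0 : V3) N).exists_bound_of_continuousOn
    ((hU.continuous_fderiv (by simp)).continuousOn)
  obtain ⟨C₂, hC₂⟩ := (isCompact_closedBall (0 : V3) N).exists_bound_of_continuousOn
    ((hS.continuous_fderiv (by simp)).continuousOn)
  refine ⟨max (max C₁ C₂) 3, fun y => ?_⟩
  by_cases hy : ‖y‖ ≤ N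
  · have hmem : y ∈ Metric.closedBall (0 : V3) N := by simpa using hy
    exact ⟨(hC₁ y hmem).trans ((le_max_left _ _).trans (le_max_left _ _)),
      (hC₂ y hmem).trans ((le_max_right _ _).trans (le_max_left _ _))⟩
  · have hy' : N < ‖y‖ := not_le.mp hy
    have hyN : N ≤ ‖y‖ := hy'.le
    have hy0 : y ≠ 0 := by
      rintro rfl
      rw [norm_zero] at hy'
      linarith
    have hζ : 0 < ‖y‖ := norm_pos_iff.2 hy0
    have hUd := ((contDiffAt_profile_of_radialField hU hζ).differentiableAt (by simp)).hasDerivAt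
    have hSd := ((contDiffAt_profile_of_radialScalar hS hζ).differentiableAt (by simp)).hasDerivAt
    have b1 : |U ‖y‖ / ‖y‖| < 1 := by
      have := hN₁ ‖y‖ (le_trans (le_max_of_le_left (le_max_left _ _)) hyN)
      rwa [Real.dist_eq, sub_zero] at this
    have b2 : |deriv U ‖y‖| < 1 := by
      have := hN₂ ‖y‖ (le_trans (le_max_of_le_left (le_max_right _ _)) hyN)
      rwa [Real.dist_eq, sub_zero] at this
    have b3 : |deriv S ‖y‖| < 1 := by
      have := hN₃ ‖y‖ (le_trans (le_max_of_le_right (le_max_left _ _)) hyN)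
      rwa [Real.dist_eq, sub_zero] at this
    constructor
    · refine (norm_fderiv_radialField_le hy0 hUd).trans ?_
      refine le_trans ?_ (le_max_right _ _)
      linarith
    · rw [norm_fderiv_radialScalar hy0 hSd]
      exact le_trans (by linarith) (le_max_right _ _)

end Decay

/-! ### Type-I bounds for the exact solution -/

section TypeI

variable {r T : ℝ} {U S : ℝ → ℝ} {Ub : V3 → V3} {Sb : V3 → ℝ} {u : ℝ → V3 → V3}
  {σ ρ : ℝ → V3 → ℝ}

/-- **Type-I bounds for the exact self-similar solution.** Under the hypotheses of
`exactSolution_of_profile` and the end-point condition `U/ζ, S/ζ → 0` of the vendored profile fact,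
the first derivatives of `u` and of `ρ^{1/3} = σ/3` are `O(1/(T−t))` uniformly on `ℝ³`:
`‖∂ᵢu(t,·)‖_∞, ‖∂ᵢρ^{1/3}(t,·)‖_∞ ≤ C/(T−t)` (the Euclidean, exact-solution form of the Type-I clause
of `CaolaboraEtAl2025_thm12_rates`, there read off Lemma 3.6).
[cite: CaolaboraEtAl2025, §1.3 p. 5; Lemma 3.6 p. 26] [cite: BuckmasterCaolaboraGomezserrano2025, Thm 1.1 p. 4] -/
theorem typeI_of_profile (hr : 0 < r)
    (hU : ContDiff ℝ ∞ fun y : V3 => (U ‖y‖ / ‖y‖) • y) (hS : ContDiff ℝ ∞ fun y : V3 => S ‖y‖)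
    (hode : ∀ ζ : ℝ, 0 < ζ →
      (r - 1) * U ζ + (ζ + U ζ) * deriv U ζ + 1 / 3 * S ζ * deriv S ζ = 0 ∧
      (r - 1) * S ζ + (ζ + U ζ) * deriv S ζ + 1 / 3 * S ζ * (deriv U ζ + 2 * U ζ / ζ) = 0)
    (hSpos : ∀ ζ : ℝ, 0 ≤ ζ → 0 < S ζ)
    (hlimU : Tendsto (fun ζ => U ζ / ζ) atTop (𝓝 0))
    (hlimS : Tendsto (fun ζ => S ζ / ζ) atTop (𝓝 0))
    (hUb : Ub = fun y : V3 => (U ‖y‖ / ‖y‖) • y) (hSb : Sb = fun y : V3 => S ‖y‖)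
    (hu : ∀ t x, u t x = (r⁻¹ * (T - t) ^ (1 / r - 1)) • Ub ((T - t) ^ (-1 / r) • x))
    (hσ : ∀ t x, σ t x = (r⁻¹ * (T - t) ^ (1 / r - 1)) * Sb ((T - t) ^ (-1 / r) • x))
    (hρ : ∀ t x, ρ t x = (σ t x / 3) ^ 3) :
    ∃ C : ℝ, ∀ t < T, ∀ x (i : Fin 3),
      ‖fderiv ℝ (u t) x (EuclideanSpace.single i 1)‖ ≤ C / (T - t) ∧
      |fderiv ℝ (fun z => ρ t z ^ (1 / 3 : ℝ)) x (EuclideanSpace.single i 1)| ≤ C / (T - t) := by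
  obtain ⟨M, hM⟩ := exists_bound_fderiv_profile hU hS hode hlimU hlimS
  obtain ⟨-, -, -, -, -, -, hTI⟩ := exactSolution_of_profile (T := T) hr hU hS hode hSpos hUb hSb hu hσ hρ
  refine ⟨M / r, fun t ht x i => ?_⟩
  have hl0 : 0 < T - t := sub_pos.mpr ht
  obtain ⟨hux, hρx⟩ := hTI t ht x
  set y : V3 := (T - t) ^ (-1 / r) • x with hy
  obtain ⟨hMU, hMS⟩ := hM y
  rw [← hUb] at hMU
  rw [← hSb] at hMS
  have hM0 : 0 ≤ M := (norm_nonneg _).trans hMU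
  have hc : 0 < r⁻¹ * (T - t)⁻¹ := mul_pos (inv_pos.2 hr) (inv_pos.2 hl0)
  have he1 : ‖(EuclideanSpace.single i (1 : ℝ) : V3)‖ = 1 := by
    rw [PiLp.norm_single, norm_one]
  have hgoal : r⁻¹ * (T - t)⁻¹ * M = M / r / (T - t) := by
    field_simp
  constructor
  · rw [hux, FunLike.coe_smul, Pi.smul_apply, norm_smul, Real.norm_eq_abs, abs_of_pos hc, ← hgoal]
    refine mul_le_mul_of_nonneg_left ?_ hc.le
    exact ((fderiv ℝ Ub y).le_opNorm _).trans (by rw [he1, mul_one]; exact hMU)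
  · rw [hρx, FunLike.coe_smul, Pi.smul_apply, smul_eq_mul, abs_mul,
      abs_of_pos (mul_pos (by norm_num) hc), ← hgoal]
    have hℓ : |fderiv ℝ Sb y (EuclideanSpace.single i 1)| ≤ M := by
      refine (Real.norm_eq_abs _ ▸ (fderiv ℝ Sb y).le_opNorm _).trans ?_
      rw [he1, mul_one]; exact hMS
    calc 1 / 3 * (r⁻¹ * (T - t)⁻¹) * |fderiv ℝ Sb y (EuclideanSpace.single i 1)|
        ≤ 1 / 3 * (r⁻¹ * (T - t)⁻¹) * M := by gcongr
      _ ≤ r⁻¹ * (T - t)⁻¹ * M := by nlinarith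

/-- **Exact self-similar implosion on `ℝ³` with the core law and Type-I bounds, from the vendored
profile fact** (the Euclidean, exact-solution counterparts of the first and last rate clauses of
`CaolaboraEtAl2025_thm12_rates`). [cite: BuckmasterCaolaboraGomezserrano2025, Thm 1.1 p. 4]
[cite: CaolaboraEtAl2025, eq. (1.1) p. 3; §1.3 p. 5; Lemma 3.6 p. 26] -/
theorem exact_selfSimilar_implosion_typeI_of_thm11_monatomic
    (hX : BuckmasterCaolaboraGomezserrano2025_thm11_monatomic) :
    ∃ r : ℝ, 1.10102 < r ∧ r < 1.13476 ∧ ∀ T : ℝ, ∃ (ρ : ℝ → V3 → ℝ) (u : ℝ → V3 → V3),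
      ContDiffOn ℝ ∞ (fun p : ℝ × V3 => ρ p.1 p.2) {p | p.1 < T} ∧
      ContDiffOn ℝ ∞ (fun p : ℝ × V3 => u p.1 p.2) {p | p.1 < T} ∧
      (∀ t < T, ∀ x, 0 < ρ t x) ∧
      (∀ t < T, ∀ x, deriv (fun τ => ρ τ x) t +
          ∑ i, fderiv ℝ (fun z => ρ t z * u t z i) x (EuclideanSpace.single i 1) = 0) ∧
      (∀ t < T, ∀ x, ρ t x • deriv (fun τ => u τ x) t +
            ρ t x • ∑ i, u t x i • fderiv ℝ (u t) x (EuclideanSpace.single i 1) +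
          gradient (fun z => ρ t z ^ (5 / 3 : ℝ) / (5 / 3)) x = 0) ∧
      (∃ C : ℝ, ∀ t < T, ∀ x (i : Fin 3),
          ‖fderiv ℝ (u t) x (EuclideanSpace.single i 1)‖ ≤ C / (T - t) ∧
          |fderiv ℝ (fun z => ρ t z ^ (1 / 3 : ℝ)) x (EuclideanSpace.single i 1)| ≤ C / (T - t)) ∧
      ∃ c : ℝ, 0 < c ∧ ∀ t < T, ρ t 0 = c * (T - t) ^ (-(3 * (1 - 1 / r))) := by
  obtain ⟨r, hr1, hr2, U, S, hU, hS, hode, hpos, hlimU, hlimS⟩ := hX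
  have hr : 0 < r := by linarith
  refine ⟨r, hr1, hr2, fun T => ?_⟩
  set Ub : V3 → V3 := fun y => (U ‖y‖ / ‖y‖) • y with hUb
  set Sb : V3 → ℝ := fun y => S ‖y‖ with hSb
  set u : ℝ → V3 → V3 := fun t x => (r⁻¹ * (T - t) ^ (1 / r - 1)) • Ub ((T - t) ^ (-1 / r) • x)
    with hu
  set σ : ℝ → V3 → ℝ := fun t x => (r⁻¹ * (T - t) ^ (1 / r - 1)) * Sb ((T - t) ^ (-1 / r) • x)
    with hσ
  set ρ : ℝ → V3 → ℝ := fun t x => (σ t x / 3) ^ 3 with hρ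
  obtain ⟨h1, h2, h3, h4, h5, h6, -⟩ := exactSolution_of_profile (T := T) (u := u) (σ := σ) (ρ := ρ)
    hr hU hS hode hpos hUb hSb (fun _ _ => rfl) (fun _ _ => rfl) (fun _ _ => rfl)
  have h7 := typeI_of_profile (T := T) (u := u) (σ := σ) (ρ := ρ)
    hr hU hS hode hpos hlimU hlimS hUb hSb (fun _ _ => rfl) (fun _ _ => rfl) (fun _ _ => rfl)
  refine ⟨ρ, u, h1, h2, h3, h4, h5, h7, (S 0 / (3 * r)) ^ 3, ?_, h6⟩
  exact pow_pos (div_pos (hpos 0 le_rfl) (by positivity)) 3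

end TypeI

/-! ### Far-field control of the profile and the integrable speed bound of the exact solution -/

section FarField

variable {r : ℝ} {U S : ℝ → ℝ}

/-- **The profile energy `Q = U² + S²` decreases at infinity at least like `ζ^{−2(r−1)/3}`:
differential inequality.** For profiles solving the radial profile equations (`ζ > 0`) with the
end-point condition `U/ζ, S/ζ → 0` (hence `U′, S′ → 0`, `tendsto_deriv_profile_atTop`) and `r > 1`,
eventually `2 (U U′ + S S′) ≤ −(2(r−1)/3) (U² + S²)/ζ`: multiply the `U`-equation by `U` and the
`S`-equation by `S`, `(ζ + U)(UU′ + SS′) = −(r−1)Q − ⅓S(US′ + SU′) − ⅔S²U/ζ`, and absorb the last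
two terms (`≤ (5/12)(r−1) Q` once `|U′|, |S′| ≤ (r−1)/2`, `|U/ζ| ≤ (r−1)/4 ∧ 1/2`).
(The source records the sharp decay `|Ū| + |S̄| ≲ ⟨R⟩^{−(r−1)}`, p. 6; this weaker rate suffices for
boundedness.) [cite: CaolaboraEtAl2025, §1.3 p. 5 (profile equations), p. 6 (decay of the profiles)] -/
theorem profile_energy_deriv_le (hr : 1 < r)
    (hode : ∀ ζ : ℝ, 0 < ζ →
      (r - 1) * U ζ + (ζ + U ζ) * deriv U ζ + 1 / 3 * S ζ * deriv S ζ = 0 ∧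
      (r - 1) * S ζ + (ζ + U ζ) * deriv S ζ + 1 / 3 * S ζ * (deriv U ζ + 2 * U ζ / ζ) = 0)
    (hlimU : Tendsto (fun ζ => U ζ / ζ) atTop (𝓝 0))
    (hlimS : Tendsto (fun ζ => S ζ / ζ) atTop (𝓝 0)) :
    ∀ᶠ ζ in atTop, 2 * (U ζ * deriv U ζ + S ζ * deriv S ζ) ≤
      -(2 * (r - 1) / 3) * (U ζ ^ 2 + S ζ ^ 2) / ζ := by
  obtain ⟨hdU, hdS⟩ := tendsto_deriv_profile_atTop hode hlimU hlimS
  have hr1 : 0 < r - 1 := sub_pos.2 hr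
  have hε : 0 < min ((r - 1) / 4) (1 / 2) := lt_min (by linarith) (by norm_num)
  filter_upwards [eventually_gt_atTop (0 : ℝ), Metric.tendsto_nhds.1 hlimU _ hε,
    Metric.tendsto_nhds.1 hdU _ (half_pos hr1), Metric.tendsto_nhds.1 hdS _ (half_pos hr1)]
    with ζ hζ hb1 hb2 hb3
  rw [Real.dist_eq, sub_zero] at hb1 hb2 hb3
  obtain ⟨h1, h2⟩ := hode ζ hζ
  have hp2 : 2 * U ζ / ζ = 2 * (U ζ / ζ) := by ring
  rw [hp2] at h2
  have hup : U ζ = U ζ / ζ * ζ := by field_simp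
  have hpa : |U ζ / ζ| ≤ 1 / 2 := (lt_of_lt_of_le hb1 (min_le_right _ _)).le
  have hpb : |U ζ / ζ| ≤ (r - 1) / 4 := (lt_of_lt_of_le hb1 (min_le_left _ _)).le
  -- pass to opaque real variables
  generalize U ζ / ζ = p at h2 hup hpa hpb
  generalize U ζ = u at h1 h2 hup ⊢
  generalize S ζ = s at h1 h2 ⊢
  generalize deriv U ζ = u' at h1 h2 hb2 ⊢
  generalize deriv S ζ = s' at h1 h2 hb3 ⊢
  have hpa' := abs_le.1 hpa
  have hQ0 : 0 ≤ u ^ 2 + s ^ 2 := by positivity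
  -- the identity `(ζ + u)(u u' + s s') = −(r−1)(u²+s²) − ⅓ s (u s' + s u') − ⅔ s² p`
  have hid : (ζ + u) * (u * u' + s * s') =
      -(r - 1) * (u ^ 2 + s ^ 2) - 1 / 3 * s * (u * s' + s * u') - 2 / 3 * s ^ 2 * p := by
    linear_combination u * h1 + s * h2
  -- bound the right-hand side by `−(r−1)(u²+s²)/2`
  have hsu : |s * u| ≤ (u ^ 2 + s ^ 2) / 2 := by
    rw [abs_le]; constructor <;> nlinarith [sq_nonneg (u + s), sq_nonneg (u - s)]
  have hs2 : s ^ 2 ≤ u ^ 2 + s ^ 2 := by nlinarith [sq_nonneg u]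
  have t1 : |1 / 3 * s * (u * s')| ≤ (r - 1) / 12 * (u ^ 2 + s ^ 2) := by
    rw [show 1 / 3 * s * (u * s') = 1 / 3 * ((s * u) * s') by ring, abs_mul, abs_mul,
      abs_of_pos (by norm_num : (0 : ℝ) < 1 / 3)]
    have h : |s * u| * |s'| ≤ (u ^ 2 + s ^ 2) / 2 * ((r - 1) / 2) :=
      mul_le_mul hsu hb3.le (abs_nonneg _) (by positivity)
    linarith
  have t2 : |1 / 3 * s * (s * u')| ≤ (r - 1) / 6 * (u ^ 2 + s ^ 2) := by
    rw [show 1 / 3 * s * (s * u') = 1 / 3 * (s ^ 2 * u') by ring, abs_mul, abs_mul,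
      abs_of_pos (by norm_num : (0 : ℝ) < 1 / 3), abs_of_nonneg (sq_nonneg s)]
    have h : s ^ 2 * |u'| ≤ (u ^ 2 + s ^ 2) * ((r - 1) / 2) :=
      mul_le_mul hs2 hb2.le (abs_nonneg _) hQ0
    linarith
  have t3 : |2 / 3 * s ^ 2 * p| ≤ (r - 1) / 6 * (u ^ 2 + s ^ 2) := by
    rw [abs_mul, abs_mul, abs_of_pos (by norm_num : (0 : ℝ) < 2 / 3), abs_of_nonneg (sq_nonneg s)]
    have h : s ^ 2 * |p| ≤ (u ^ 2 + s ^ 2) * ((r - 1) / 4) :=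
      mul_le_mul hs2 hpb (abs_nonneg _) hQ0
    linarith
  have hQr : 0 ≤ (r - 1) * (u ^ 2 + s ^ 2) := mul_nonneg hr1.le hQ0
  have hB : (ζ + u) * (u * u' + s * s') ≤ -((r - 1) / 2) * (u ^ 2 + s ^ 2) := by
    rw [hid]
    have e1 := neg_abs_le (1 / 3 * s * (u * s'))
    have e2 := neg_abs_le (1 / 3 * s * (s * u'))
    have e3 := neg_abs_le (2 / 3 * s ^ 2 * p)
    have hsplit : 1 / 3 * s * (u * s' + s * u') = 1 / 3 * s * (u * s') + 1 / 3 * s * (s * u') := by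
      ring
    rw [hsplit]
    linarith
  -- `ζ/2 ≤ ζ + u ≤ 3ζ/2`, so `X = u u' + s s' ≤ 0` and `ζ X ≤ ⅔ (ζ + u) X`
  have hzu1 : ζ / 2 ≤ ζ + u := by
    have h : 0 ≤ (p + 1 / 2) * ζ := mul_nonneg (by linarith [hpa'.1]) hζ.le
    rw [hup]; linarith
  have hzu2 : ζ + u ≤ 3 / 2 * ζ := by
    have h : 0 ≤ (1 / 2 - p) * ζ := mul_nonneg (by linarith [hpa'.2]) hζ.le
    rw [hup]; linarith
  have hzu : 0 < ζ + u := by linarith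
  have hX : u * u' + s * s' ≤ 0 := by
    by_contra hcon
    have hcon' : 0 < u * u' + s * s' := lt_of_not_ge hcon
    have h := mul_pos hzu hcon'
    linarith
  have hprod : 0 ≤ (3 / 2 * ζ - (ζ + u)) * (-(u * u' + s * s')) :=
    mul_nonneg (by linarith) (by linarith)
  have hkey : ζ * (u * u' + s * s') ≤ -((r - 1) / 3) * (u ^ 2 + s ^ 2) := by
    linarith
  rw [le_div_iff₀ hζ]
  linarith

/-- **Algebraic decay of the profile energy:** `U(ζ)² + S(ζ)² ≤ C ζ^{−2(r−1)/3}` for `ζ ≥ ζ₀`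
(`ζ^{2(r−1)/3}(U² + S²)` is non-increasing beyond `ζ₀` by `profile_energy_deriv_le`).
[cite: CaolaboraEtAl2025, p. 6 (decay of the profiles)] -/
theorem profile_sq_le_rpow (hr : 1 < r)
    (hU : ContDiff ℝ ∞ fun y : V3 => (U ‖y‖ / ‖y‖) • y) (hS : ContDiff ℝ ∞ fun y : V3 => S ‖y‖)
    (hode : ∀ ζ : ℝ, 0 < ζ →
      (r - 1) * U ζ + (ζ + U ζ) * deriv U ζ + 1 / 3 * S ζ * deriv S ζ = 0 ∧
      (r - 1) * S ζ + (ζ + U ζ) * deriv S ζ + 1 / 3 * S ζ * (deriv U ζ + 2 * U ζ / ζ) = 0)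
    (hlimU : Tendsto (fun ζ => U ζ / ζ) atTop (𝓝 0))
    (hlimS : Tendsto (fun ζ => S ζ / ζ) atTop (𝓝 0)) :
    ∃ ζ₀ C : ℝ, 0 < ζ₀ ∧ 0 ≤ C ∧ ∀ ζ, ζ₀ ≤ ζ →
      U ζ ^ 2 + S ζ ^ 2 ≤ C * ζ ^ (-(2 * (r - 1) / 3)) := by
  obtain ⟨ζ₁, hζ₁⟩ := Filter.eventually_atTop.1 (profile_energy_deriv_le hr hode hlimU hlimS)
  set ζ₀ : ℝ := max ζ₁ 1 with hζ₀def
  have hζ₀ : 0 < ζ₀ := lt_of_lt_of_le one_pos (le_max_right _ _)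
  have hineq : ∀ ζ, ζ₀ ≤ ζ → 2 * (U ζ * deriv U ζ + S ζ * deriv S ζ) ≤
      -(2 * (r - 1) / 3) * (U ζ ^ 2 + S ζ ^ 2) / ζ := fun ζ hζ => hζ₁ ζ ((le_max_left _ _).trans hζ)
  set κ : ℝ := 2 * (r - 1) / 3 with hκ
  have hκ0 : 0 < κ := by rw [hκ]; linarith
  set F : ℝ → ℝ := fun ζ => ζ ^ κ * (U ζ ^ 2 + S ζ ^ 2) with hF
  -- differentiability of `U`, `S` at `ζ > 0`
  have hUd : ∀ ζ, 0 < ζ → HasDerivAt U (deriv U ζ) ζ := fun ζ hζ =>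
    ((contDiffAt_profile_of_radialField hU hζ).differentiableAt (by simp)).hasDerivAt
  have hSd : ∀ ζ, 0 < ζ → HasDerivAt S (deriv S ζ) ζ := fun ζ hζ =>
    ((contDiffAt_profile_of_radialScalar hS hζ).differentiableAt (by simp)).hasDerivAt
  have hFd : ∀ ζ, 0 < ζ → HasDerivAt F (κ * ζ ^ (κ - 1) * (U ζ ^ 2 + S ζ ^ 2) +
      ζ ^ κ * (2 * (U ζ * deriv U ζ + S ζ * deriv S ζ))) ζ := by
    intro ζ hζ
    have hpow : HasDerivAt (fun x : ℝ => x ^ κ) (κ * ζ ^ (κ - 1)) ζ :=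
      Real.hasDerivAt_rpow_const (Or.inl hζ.ne')
    have hQ : HasDerivAt (fun x => U x ^ 2 + S x ^ 2)
        (2 * (U ζ * deriv U ζ + S ζ * deriv S ζ)) ζ := by
      have h := ((hUd ζ hζ).mul (hUd ζ hζ)).add ((hSd ζ hζ).mul (hSd ζ hζ))
      have hfun : (fun x => U x ^ 2 + S x ^ 2) = fun x => U x * U x + S x * S x := by
        funext x; ring
      rw [hfun]
      refine h.congr_deriv ?_
      ring
    have h := hpow.mul hQ
    refine h.congr_deriv ?_
    ring
  -- `F' ≤ 0` beyond `ζ₀`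
  have hF'le : ∀ ζ, ζ₀ ≤ ζ → κ * ζ ^ (κ - 1) * (U ζ ^ 2 + S ζ ^ 2) +
      ζ ^ κ * (2 * (U ζ * deriv U ζ + S ζ * deriv S ζ)) ≤ 0 := by
    intro ζ hζ
    have hζpos : 0 < ζ := hζ₀.trans_le hζ
    have hQ0 : 0 ≤ U ζ ^ 2 + S ζ ^ 2 := by positivity
    have h1 : ζ ^ κ * (2 * (U ζ * deriv U ζ + S ζ * deriv S ζ)) ≤
        ζ ^ κ * (-(2 * (r - 1) / 3) * (U ζ ^ 2 + S ζ ^ 2) / ζ) :=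
      mul_le_mul_of_nonneg_left (hineq ζ hζ) (Real.rpow_nonneg hζpos.le _)
    have h2 : ζ ^ κ * (-(2 * (r - 1) / 3) * (U ζ ^ 2 + S ζ ^ 2) / ζ) =
        -(κ * ζ ^ (κ - 1) * (U ζ ^ 2 + S ζ ^ 2)) := by
      rw [Real.rpow_sub_one hζpos.ne', hκ]
      field_simp
    linarith
  -- `F` is non-increasing on `[ζ₀, ∞)`
  have hFcont : ContinuousOn F (Ici ζ₀) := by
    intro ζ hζ
    have hζpos : 0 < ζ := hζ₀.trans_le hζ
    exact (hFd ζ hζpos).continuousAt.continuousWithinAt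
  have hFanti : AntitoneOn F (Ici ζ₀) := by
    refine antitoneOn_of_deriv_nonpos (convex_Ici ζ₀) hFcont ?_ ?_
    · intro ζ hζ
      rw [interior_Ici] at hζ
      exact (hFd ζ (hζ₀.trans hζ)).differentiableAt.differentiableWithinAt
    · intro ζ hζ
      rw [interior_Ici] at hζ
      rw [(hFd ζ (hζ₀.trans hζ)).deriv]
      exact hF'le ζ hζ.le
  have hF0 : 0 ≤ F ζ₀ := mul_nonneg (Real.rpow_nonneg hζ₀.le _) (by positivity)
  refine ⟨ζ₀, F ζ₀, hζ₀, hF0, fun ζ hζ => ?_⟩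
  have hζpos : 0 < ζ := hζ₀.trans_le hζ
  have hle : F ζ ≤ F ζ₀ := hFanti (self_mem_Ici) hζ hζ
  have hpos : 0 < ζ ^ κ := Real.rpow_pos_of_pos hζpos κ
  have hinv : ζ ^ (-κ) = (ζ ^ κ)⁻¹ := Real.rpow_neg hζpos.le κ
  rw [show -(2 * (r - 1) / 3) = -κ by rw [hκ], hinv, ← div_eq_mul_inv, le_div_iff₀ hpos]
  calc (U ζ ^ 2 + S ζ ^ 2) * ζ ^ κ = F ζ := by simp only [hF]; ring
    _ ≤ F ζ₀ := hle

/-- **The profile fields are bounded on `ℝ³`:** `‖Ū(y)‖, |S̄(y)| ≤ M` (continuity on the ball of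
radius `ζ₀`, algebraic decay beyond it). [cite: CaolaboraEtAl2025, p. 6 (decay of the profiles, `j = 0`)] -/
theorem exists_bound_profile (hr : 1 < r)
    (hU : ContDiff ℝ ∞ fun y : V3 => (U ‖y‖ / ‖y‖) • y) (hS : ContDiff ℝ ∞ fun y : V3 => S ‖y‖)
    (hode : ∀ ζ : ℝ, 0 < ζ →
      (r - 1) * U ζ + (ζ + U ζ) * deriv U ζ + 1 / 3 * S ζ * deriv S ζ = 0 ∧
      (r - 1) * S ζ + (ζ + U ζ) * deriv S ζ + 1 / 3 * S ζ * (deriv U ζ + 2 * U ζ / ζ) = 0)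
    (hlimU : Tendsto (fun ζ => U ζ / ζ) atTop (𝓝 0))
    (hlimS : Tendsto (fun ζ => S ζ / ζ) atTop (𝓝 0)) :
    ∃ M : ℝ, 0 ≤ M ∧ ∀ y : V3, ‖(U ‖y‖ / ‖y‖) • y‖ ≤ M ∧ |S ‖y‖| ≤ M := by
  obtain ⟨ζ₀, C, hζ₀, hC0, hdec⟩ := profile_sq_le_rpow hr hU hS hode hlimU hlimS
  obtain ⟨C₁, hC₁⟩ := (isCompact_closedBall (0 : V3) ζ₀).exists_bound_of_continuousOn
    hU.continuous.continuousOn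
  obtain ⟨C₂, hC₂⟩ := (isCompact_closedBall (0 : V3) ζ₀).exists_bound_of_continuousOn
    hS.continuous.continuousOn
  set C₀ : ℝ := C * ζ₀ ^ (-(2 * (r - 1) / 3)) with hC₀
  have hC₀0 : 0 ≤ C₀ := mul_nonneg hC0 (Real.rpow_nonneg hζ₀.le _)
  refine ⟨max (max C₁ C₂) (1 + C₀), le_max_of_le_right (by linarith), fun y => ?_⟩
  by_cases hy : ‖y‖ ≤ ζ₀
  · have hmem : y ∈ Metric.closedBall (0 : V3) ζ₀ := by simpa using hy
    refine ⟨(hC₁ y hmem).trans ((le_max_left _ _).trans (le_max_left _ _)), ?_⟩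
    have h := hC₂ y hmem
    rw [Real.norm_eq_abs] at h
    exact h.trans ((le_max_right _ _).trans (le_max_left _ _))
  · have hy' : ζ₀ < ‖y‖ := not_le.mp hy
    have hζ : 0 < ‖y‖ := hζ₀.trans hy'
    -- decay bound at `ζ = ‖y‖ ≥ ζ₀`
    have hQ : U ‖y‖ ^ 2 + S ‖y‖ ^ 2 ≤ C₀ := by
      refine (hdec ‖y‖ hy'.le).trans ?_
      rw [hC₀]
      refine mul_le_mul_of_nonneg_left ?_ hC0
      exact Real.rpow_le_rpow_of_nonpos hζ₀ hy'.le (by linarith [show 0 < 2 * (r - 1) / 3 by linarith])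
    have hUabs : |U ‖y‖| ≤ 1 + C₀ := by
      nlinarith [sq_nonneg (|U ‖y‖| - 1), sq_abs (U ‖y‖), sq_nonneg (S ‖y‖), abs_nonneg (U ‖y‖)]
    have hSabs : |S ‖y‖| ≤ 1 + C₀ := by
      nlinarith [sq_nonneg (|S ‖y‖| - 1), sq_abs (S ‖y‖), sq_nonneg (U ‖y‖), abs_nonneg (S ‖y‖)]
    have hnorm : ‖(U ‖y‖ / ‖y‖) • y‖ = |U ‖y‖| := by
      rw [norm_smul, Real.norm_eq_abs, abs_div, abs_of_pos hζ, div_mul_cancel₀ _ hζ.ne']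
    rw [hnorm]
    exact ⟨hUabs.trans (le_max_right _ _), hSabs.trans (le_max_right _ _)⟩

/-- **Integrable bound for the characteristic speed of the exact solution.** With `M` a bound for
the profile fields, the exact self-similar solution satisfies, for all `t < T` and ALL `x ∈ ℝ³`,
`‖u(t,x)‖ + |⅓σ(t,x)| ≤ (4M/3) r⁻¹ (T−t)^{1/r−1}` — unbounded as `t → T⁻` but integrable in time
(`1/r − 1 > −1`), which is what the domain-of-dependence argument near the implosion requires
(`IsentropicEuler.eqOn_cone_of_eqOn_ball_var`).
[cite: CaolaboraEtAl2025, §1.3 p. 5 (self-similar ansatz), Rem. 1.5 p. 7] -/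
theorem speed_bound_of_profile {T : ℝ} {Ub : V3 → V3} {Sb : V3 → ℝ} {u : ℝ → V3 → V3}
    {σ : ℝ → V3 → ℝ} (hr : 1 < r)
    (hU : ContDiff ℝ ∞ fun y : V3 => (U ‖y‖ / ‖y‖) • y) (hS : ContDiff ℝ ∞ fun y : V3 => S ‖y‖)
    (hode : ∀ ζ : ℝ, 0 < ζ →
      (r - 1) * U ζ + (ζ + U ζ) * deriv U ζ + 1 / 3 * S ζ * deriv S ζ = 0 ∧
      (r - 1) * S ζ + (ζ + U ζ) * deriv S ζ + 1 / 3 * S ζ * (deriv U ζ + 2 * U ζ / ζ) = 0)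
    (hlimU : Tendsto (fun ζ => U ζ / ζ) atTop (𝓝 0))
    (hlimS : Tendsto (fun ζ => S ζ / ζ) atTop (𝓝 0))
    (hUb : Ub = fun y : V3 => (U ‖y‖ / ‖y‖) • y) (hSb : Sb = fun y : V3 => S ‖y‖)
    (hu : ∀ t x, u t x = (r⁻¹ * (T - t) ^ (1 / r - 1)) • Ub ((T - t) ^ (-1 / r) • x))
    (hσ : ∀ t x, σ t x = (r⁻¹ * (T - t) ^ (1 / r - 1)) * Sb ((T - t) ^ (-1 / r) • x)) :
    ∃ M : ℝ, 0 ≤ M ∧ ∀ t < T, ∀ x,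
      ‖u t x‖ + |1 / 3 * σ t x| ≤ M * (r⁻¹ * (T - t) ^ (1 / r - 1)) := by
  obtain ⟨M, hM0, hM⟩ := exists_bound_profile hr hU hS hode hlimU hlimS
  have hr0 : 0 < r := by linarith
  refine ⟨M + M / 3, by positivity, fun t ht x => ?_⟩
  have hl0 : 0 < T - t := sub_pos.mpr ht
  have ha : 0 < r⁻¹ * (T - t) ^ (1 / r - 1) := mul_pos (inv_pos.2 hr0) (Real.rpow_pos_of_pos hl0 _)
  set y : V3 := (T - t) ^ (-1 / r) • x with hy
  have h1 : ‖Ub y‖ ≤ M := by rw [hUb]; exact (hM y).1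
  have h2 : |Sb y| ≤ M := by rw [hSb]; exact (hM y).2
  have hnu : ‖u t x‖ = (r⁻¹ * (T - t) ^ (1 / r - 1)) * ‖Ub y‖ := by
    rw [hu, norm_smul, Real.norm_eq_abs, abs_of_pos ha]
  have hnσ : |1 / 3 * σ t x| = (r⁻¹ * (T - t) ^ (1 / r - 1)) * (|Sb y| / 3) := by
    rw [hσ, ← hy, abs_mul, abs_mul, abs_of_pos ha, abs_of_pos (by norm_num : (0 : ℝ) < 1 / 3)]
    ring
  rw [hnu, hnσ]
  have h1' := mul_le_mul_of_nonneg_left h1 ha.le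
  have h2' := mul_le_mul_of_nonneg_left h2 ha.le
  nlinarith [h1', h2']

end FarField

end CaolaboraEtAl2025

end Literature.Analysis.FluidPDE

end
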